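import Literature.NumberTheory.LFunctions.DirichletLFunctionLogDerivBound
import HarnessLib

/-!
# The zero-free region for twisted `L`-functions over a number field, axiomatised (MV §11.1 for `K`)

Topic `Literature/NumberTheory/LFunctions`, next to `ClassicalZeroFreeRegion.lean` (the
de la Vallée-Poussin–Landau region for a self-dual `L`-function WITH a pole, abstract pair
`(Λ, G)`), `DirichletLFunctionBounds/ZeroFreeRegion/LogDerivBound.lean` (Montgomery–Vaughan
§11.1, Theorems 11.3–11.4, for Dirichlet characters) and `LogRieszMeanConductor.lean` (Perron's
formula uniformly in a conductor). Everything in this file is PROVED.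

**Purpose.** The prime number theorem for Hecke characters `ν` of a number field `K`
(ray-class characters twisted by Grössencharaktere; I. Mitsui, *Generalized prime number theorem*,
Jap. J. Math. 26 (1956), Lemma 5 — the input "Lemma 9.4" of D. R. Heath-Brown, *Primes represented
by `x³ + 2y³`*, Acta Math. 186 (2001), §9) needs the region
`σ > 1 − c/(log Q + log(|t| + 4))` free of zeros of `L(s, ν)` (`Q` = norm of the conductor times
the size of the infinity type), except for real zeros of real characters, with `c` INDEPENDENT of
`Q` and of `ν`, and the bound `L'/L(s, ν) ≪ (log Q + log(|t|+4))^{O(1)}` there. Mathlib and the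
tree have this for `ζ`, `ζ_K` and Dirichlet `L`-functions only. Following the pattern of
`ClassicalZeroFreeRegion.lean`, we isolate the hypotheses under which Montgomery–Vaughan's proof of
Theorem 11.3 (pp. 275–277, Cases 1–3) goes through, and run it once for an abstract datum:

* `Λ₀ : ℕ → ℝ`, `Λ₀ ≥ 0` with `∑ Λ₀(n) n^{-s}` absolutely convergent for `σ > 1` and
  `Re ∑ Λ₀(n) n^{-σ} ≤ 1/(σ − 1) + K₀` for `1 < σ ≤ 2` (model: `Λ₀ = Λ_K`, `−ζ_K'/ζ_K`; supplied by
  `ClassicalZFRData.exists_bound_LSeries`);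
* `Λ₁, Λ₂ : ℕ → ℂ` with `|Λ₁|, |Λ₂| ≤ Λ₀` and the `3-4-1` positivity
  `3 Re L(Λ₀, σ) + 4 Re L(Λ₁, σ + it) + Re L(Λ₂, σ + 2it) ≥ 0` (model: `Λ₁(n) = ∑_{N𝔞 = n} ν(𝔞)Λ(𝔞)`,
  `Λ₂` the same for `ν²`; positivity from `3 + 4cos θ + cos 2θ ≥ 0` termwise);
* `F` holomorphic on `σ > 1 − η` (`0 < η ≤ 1`), non-vanishing with `F'/F = −L(Λ₁, ·)` on `σ > 1`,
  of polynomial growth `|F(s)| ≤ C_g Q^A (|t| + 4)^A` for `1 − η < σ ≤ 3` (the conductor `Q ≥ 1`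
  enters ONLY here and in the next item), and `|F(s)| ≥ c₁(σ − 1)` for `1 < σ ≤ 2` (model:
  `F = L(s, ν)`, lower bound from `L(s,ν) · ∑ μν N^{-s} = 1`);
* the companion bound for `Λ₂`: `Re L(Λ₂, s) ≤ [Re 1/(s − 1)] + C₂(log Q + log(|t| + 4))` for
  `1 < σ ≤ 2`, the bracket present iff `pole = true` (model: `ν²` non-principal — no bracket, the
  bound being `re_LSeries₁_le` below applied to the datum of `ν²` — resp. `ν²` principal, when
  `L(Λ₂, s) = −ζ_K'/ζ_K(s) + O(log Q)`);
* if `pole = true`, the reflection symmetry `F(ρ) = 0 → F(ρ̄) = 0` of the zeros (model: `ν` real).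

This is `TwistedZFRData η A C_g c₁ K₀ C₂ pole Q Λ₀ Λ₁ Λ₂ F`. Under it we prove, with constants
that are explicit functions of `η, A, C_g, c₁, K₀, C₂` alone (uniformity in `Q` and in the datum):

* `TwistedZFRData.exists_package` — **MV Lemma 11.1** for `F` (Titchmarsh's Lemma α on the discs
  `|z − (1 + η/32 + it)| ≤ η/4`): `F'/F(z) = ∑_ρ m(ρ)/(z − ρ) + O(log Q + log(|t| + 4))`;
* `re_LSeries₁_le_of_zero`, `re_LSeries₁_le`, `re_LSeries₁_real_le_of_pair` — the inequalities
  MV (11.2), (11.3);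
* `one_sub_re_ge_of_noPole` (Case 1), `one_sub_re_ge_of_pole_far` (Case 2),
  `one_sub_re_ge_of_pole_near` (Case 3), `not_zero_of_re_eq_one` (a zero `1 + iγ`, `γ ≠ 0`, is
  impossible — replacing "`L(1 + it, χ) ≠ 0`", which is not assumed);
* `TwistedZFRData.zeroFree_of_le` — **MV Theorem 11.3, abstract form**: every zero `ρ = β + iγ` of
  `F` with `β > 1 − c/(log Q + log(|γ| + 4))` has `γ = 0`, and there is none unless `pole = true`
  (for any `c > 0` below four explicit bounds in `η, A, C_g, c₁, K₀, C₂`);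
  `exists_zeroFree_const` — the same with `∃ c > 0` quantified BEFORE the data;
* `norm_logDeriv_le_of_one_lt_re`, `sum_mult_le` (MV (11.11)) and
  `TwistedZFRData.exists_logDeriv_bound_const` — **MV Theorem 11.4, crude abstract form**:
  `∃ c > 0, C ≥ 0` (before the data) with `F(s) ≠ 0` and
  `‖F'/F(s)‖ ≤ C (log Q + log 4)³/d · log(|t| + 4)` for `σ ≥ 1 − c/(log Q + log(|t|+4))`, `s` at
  distance `≥ d` from the real zeros `a > 1 − 2c/(log Q + log 4)` — the input of
  `LogRieszMeanConductor.lean` (`p = 4`, `M = C/d`, `λ = log Q`).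

## References

* H. L. Montgomery, R. C. Vaughan, *Multiplicative Number Theory I. Classical Theory*, Cambridge
  Stud. Adv. Math. 97 (2007), §11.1: Lemmas 11.1–11.2, Theorem 11.3 (proof, pp. 275–277).
  [cite: MontgomeryVaughan2007, §11.1 Theorem 11.3]
* I. Mitsui, *Generalized prime number theorem*, Jap. J. Math. 26 (1956), 1–42, Lemma 5.
  [cite: Mitsui1956, Lemma 5]
* D. R. Heath-Brown, *Primes represented by `x³ + 2y³`*, Acta Math. 186 (2001), Lemma 9.4.
  [cite: HeathBrownActa2001, Lemma 9.4]
* E. C. Titchmarsh, *The Theory of the Riemann Zeta-Function*, 2nd ed. (1986), §3.9 Lemma α.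
  [cite: Titchmarsh1986, §3.9]

## Mathlib / tree search

Tree: `Literature.Analysis.Complex.titchmarsh_logDeriv_sub_sum_of_differentiableOn` (Lemma α),
`ClassicalZFRData.re_sum_div_ge`, `ClassicalZFRData.one_le_log_tau`, `ClassicalZFRData.log_two_mul_tau_le`,
`DirichletZFR.re_sum_div_ge_pair`, `DirichletZFR.re_inv_ofReal_add_mul_I` (generic lemmas of the
Dirichlet files, reused); the Dirichlet proofs themselves (`DirichletZFR.one_sub_re_ge_of_complex`, …)
are hard-wired to `DirichletCharacter.LFunction` and the radii `13/32, 13/128` of an entire function,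
so they are re-run here with radii `η/4, η/16`. Mathlib: `LSeries`, `LSeriesSummable.of_re_le_re`,
`LSeries.norm_term_le_of_re_le_re`, `Complex.re_tsum`. No Hecke `L`-functions in Mathlib
(`lean search 'Grössencharakter|HeckeL|rayClassL.*zeroFree'`: nothing analytic).
-/

noncomputable section

open Complex Filter Topology Metric Set Finset
open scoped ComplexConjugate

namespace Literature.NumberTheory.LFunctions

/-! ## The quantity `log Q + log(|t| + 4)` for a real conductor `Q ≥ 1` -/

namespace TwistedZFR

/-- `1 ≤ log Q + log(|t| + 4)` for `Q ≥ 1`. [folklore] -/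
theorem one_le_ell {Q : ℝ} (hQ : 1 ≤ Q) (t : ℝ) : 1 ≤ Real.log Q + Real.log (|t| + 4) := by
  have h1 := ClassicalZFRData.one_le_log_tau t
  have h2 : 0 ≤ Real.log Q := Real.log_nonneg hQ
  linarith

/-- `0 < log Q + log(|t| + 4)`. [folklore] -/
theorem ell_pos {Q : ℝ} (hQ : 1 ≤ Q) (t : ℝ) : 0 < Real.log Q + Real.log (|t| + 4) :=
  one_pos.trans_le (one_le_ell hQ t)

/-- Doubling the ordinate: `log Q + log(|2t| + 4) ≤ 2 (log Q + log(|t| + 4))`. [folklore] -/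
theorem ell_two_mul_le {Q : ℝ} (hQ : 1 ≤ Q) (t : ℝ) :
    Real.log Q + Real.log (|2 * t| + 4) ≤ 2 * (Real.log Q + Real.log (|t| + 4)) := by
  have h2 : 0 ≤ Real.log Q := Real.log_nonneg hQ
  have h3 : Real.log (|2 * t| + 4) ≤ 2 * Real.log (|t| + 4) := by
    calc Real.log (|2 * t| + 4) ≤ Real.log (2 * (|t| + 4)) := by
          rw [abs_mul, abs_two]
          exact Real.log_le_log (by positivity) (by linarith [abs_nonneg t])
      _ ≤ 2 * Real.log (|t| + 4) := ClassicalZFRData.log_two_mul_tau_le t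
  linarith

/-- Height `0` is the lowest: `log Q + log(|0| + 4) ≤ log Q + log(|t| + 4)`. [folklore] -/
theorem ell_zero_le (Q t : ℝ) :
    Real.log Q + Real.log (|(0 : ℝ)| + 4) ≤ Real.log Q + Real.log (|t| + 4) := by
  rw [abs_zero]
  have : Real.log (0 + 4) ≤ Real.log (|t| + 4) :=
    Real.log_le_log (by norm_num) (by linarith [abs_nonneg t])
  linarith

/-- Nearby ordinates: if `|t'| ≤ |t| + 1` then `log Q + log(|t'| + 4) ≤ (5/4)(log Q + log(|t| + 4))`
(`Q ≥ 1`). [folklore] -/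
theorem ell_le_of_abs_le {Q : ℝ} (hQ : 1 ≤ Q) {t t' : ℝ} (h : |t'| ≤ |t| + 1) :
    Real.log Q + Real.log (|t'| + 4) ≤ 5 / 4 * (Real.log Q + Real.log (|t| + 4)) := by
  have h1 := DirichletZFR.log_tau_le_of_abs_le h
  have h2 : 0 ≤ Real.log Q := Real.log_nonneg hQ
  linarith

/-! ## Dirichlet series with a non-negative majorant -/

/-- `‖L(f, s)‖ ≤ Re L(Λ₀, σ')` for `1 < σ' ≤ Re s` when `‖f‖ ≤ Λ₀` termwise (`Λ₀ ≥ 0`).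
[folklore] -/
theorem norm_LSeries_le_of_norm_le {Λ₀ : ℕ → ℝ} {f : ℕ → ℂ} (hf : ∀ n, ‖f n‖ ≤ Λ₀ n)
    (hsum : ∀ s : ℂ, 1 < s.re → LSeriesSummable (fun n ↦ (Λ₀ n : ℂ)) s) {s : ℂ} {σ' : ℝ}
    (hσ' : 1 < σ') (hs : σ' ≤ s.re) :
    ‖LSeries f s‖ ≤ (LSeries (fun n ↦ (Λ₀ n : ℂ)) (σ' : ℂ)).re := by
  have hΛ : ∀ n, 0 ≤ Λ₀ n := fun n ↦ (norm_nonneg _).trans (hf n)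
  set g : ℕ → ℂ := fun n ↦ (Λ₀ n : ℂ)
  have hsumσ : LSeriesSummable g (σ' : ℂ) := hsum _ (by simp [hσ'])
  have h2 : ∀ n, ‖LSeries.term g (σ' : ℂ) n‖ = (LSeries.term g (σ' : ℂ) n).re := by
    intro n
    rcases eq_or_ne n 0 with rfl | hn
    · simp
    rw [LSeries.norm_term_eq, if_neg hn, LSeries.term_of_ne_zero hn, Complex.norm_real,
      Real.norm_of_nonneg (hΛ n)]
    have : (n : ℂ) ^ (σ' : ℂ) = ((n : ℝ) ^ σ' : ℝ) := by
      rw [Complex.ofReal_cpow (Nat.cast_nonneg n)]; simp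
    rw [this, ← Complex.ofReal_div, Complex.ofReal_re, Complex.ofReal_re]
  have h3 : (LSeries g (σ' : ℂ)).re = ∑' n, (LSeries.term g (σ' : ℂ) n).re := by
    rw [LSeries, Complex.re_tsum hsumσ]
  have h4 : ∀ n, ‖LSeries.term f s n‖ ≤ ‖LSeries.term g (σ' : ℂ) n‖ := by
    intro n
    rcases eq_or_ne n 0 with rfl | hn
    · simp
    have h5 : ‖LSeries.term f s n‖ ≤ ‖LSeries.term g s n‖ := by
      rw [LSeries.norm_term_eq, if_neg hn, LSeries.norm_term_eq, if_neg hn,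
        Complex.norm_real, Real.norm_of_nonneg (hΛ n)]
      exact div_le_div_of_nonneg_right (hf n) (by positivity)
    exact h5.trans (LSeries.norm_term_le_of_re_le_re g (by simp [hs]) n)
  have hfs : Summable fun n ↦ ‖LSeries.term f s n‖ :=
    Summable.of_nonneg_of_le (fun n ↦ norm_nonneg _) h4 hsumσ.norm
  calc ‖LSeries f s‖ ≤ ∑' n, ‖LSeries.term f s n‖ := norm_tsum_le_tsum_norm hfs
    _ ≤ ∑' n, ‖LSeries.term g (σ' : ℂ) n‖ := Summable.tsum_le_tsum h4 hfs hsumσ.norm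
    _ = ∑' n, (LSeries.term g (σ' : ℂ) n).re := tsum_congr h2
    _ = (LSeries g (σ' : ℂ)).re := h3.symm

/-- `L(f, ·)` converges absolutely for `σ > 1` when `‖f‖ ≤ Λ₀` termwise. [folklore] -/
theorem LSeriesSummable_of_norm_le {Λ₀ : ℕ → ℝ} {f : ℕ → ℂ} (hf : ∀ n, ‖f n‖ ≤ Λ₀ n)
    (hsum : ∀ s : ℂ, 1 < s.re → LSeriesSummable (fun n ↦ (Λ₀ n : ℂ)) s) {s : ℂ} (hs : 1 < s.re) :
    LSeriesSummable f s := by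
  have hΛ : ∀ n, 0 ≤ Λ₀ n := fun n ↦ (norm_nonneg _).trans (hf n)
  refine Summable.of_norm_bounded (hsum s hs).norm fun n ↦ ?_
  rcases eq_or_ne n 0 with rfl | hn
  · simp
  rw [LSeries.norm_term_eq, if_neg hn, LSeries.norm_term_eq, if_neg hn, Complex.norm_real,
    Real.norm_of_nonneg (hΛ n)]
  exact div_le_div_of_nonneg_right (hf n) (by positivity)

/-- Positivity of MV (11.4), abstract form: `Re L(Λ₀, σ) + Re L(f, σ) ≥ 0` for real `σ > 1` when
`‖f‖ ≤ Λ₀`. [cite: MontgomeryVaughan2007, Theorem 11.3 (proof, eq. (11.4))] -/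
theorem re_add_re_nonneg {Λ₀ : ℕ → ℝ} {f : ℕ → ℂ} (hf : ∀ n, ‖f n‖ ≤ Λ₀ n)
    (hsum : ∀ s : ℂ, 1 < s.re → LSeriesSummable (fun n ↦ (Λ₀ n : ℂ)) s) {σ : ℝ} (hσ : 1 < σ) :
    0 ≤ (LSeries (fun n ↦ (Λ₀ n : ℂ)) σ).re + (LSeries f σ).re := by
  have h := norm_LSeries_le_of_norm_le hf hsum (s := (σ : ℂ)) hσ (by simp)
  have h2 := Complex.abs_re_le_norm (LSeries f σ)
  linarith [neg_abs_le (LSeries f ↑σ).re]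

end TwistedZFR

/-! ## The hypotheses -/

/-- **Hypotheses of the zero-free-region argument for a twisted `L`-function** `F` (model:
`F = L(s, ν)` for a Hecke character `ν` of a number field `K` with conductor-parameter `Q`;
`Λ₀ = Λ_K`, `Λ₁ = νΛ_K`, `Λ₂ = ν²Λ_K` as Dirichlet coefficients in `n = N𝔞`): see the file
docstring. The numeric parameters `η, A, C_g, c₁, K₀, C₂` are those in terms of which the constants
of the conclusions are expressed; `pole` records whether `L(Λ₂, ·)` has the pole of `ζ_K` (real
`ν`). [cite: MontgomeryVaughan2007, §11.1 (Lemmas 11.1–11.2)] -/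
structure TwistedZFRData (η A Cg c₁ K₀ C₂ : ℝ) (pole : Bool) (Q : ℝ)
    (Λ₀ : ℕ → ℝ) (Λ₁ Λ₂ : ℕ → ℂ) (F : ℂ → ℂ) : Prop where
  eta_pos : 0 < η
  eta_le_one : η ≤ 1
  A_nonneg : 0 ≤ A
  Cg_pos : 0 < Cg
  c₁_pos : 0 < c₁
  K₀_nonneg : 0 ≤ K₀
  C₂_nonneg : 0 ≤ C₂
  one_le_Q : 1 ≤ Q
  /-- `Λ₀ ≥ 0`. -/
  nonneg : ∀ n, 0 ≤ Λ₀ n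
  /-- `∑ Λ₀(n) n^{-s}` converges absolutely for `σ > 1`. -/
  summable : ∀ s : ℂ, 1 < s.re → LSeriesSummable (fun n ↦ (Λ₀ n : ℂ)) s
  /-- `Re L(Λ₀, σ) ≤ 1/(σ − 1) + K₀` for `1 < σ ≤ 2` (the pole of `ζ_K`). -/
  re_LSeries₀_le : ∀ σ : ℝ, 1 < σ → σ ≤ 2 →
    (LSeries (fun n ↦ (Λ₀ n : ℂ)) σ).re ≤ 1 / (σ - 1) + K₀
  /-- `|Λ₁| ≤ Λ₀`. -/
  norm_le₁ : ∀ n, ‖Λ₁ n‖ ≤ Λ₀ n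
  /-- `|Λ₂| ≤ Λ₀`. -/
  norm_le₂ : ∀ n, ‖Λ₂ n‖ ≤ Λ₀ n
  /-- `3-4-1`: `3 Re L(Λ₀,σ) + 4 Re L(Λ₁,σ+it) + Re L(Λ₂,σ+2it) ≥ 0` for `σ > 1`. -/
  three_four_one : ∀ σ : ℝ, 1 < σ → ∀ t : ℝ,
    0 ≤ 3 * (LSeries (fun n ↦ (Λ₀ n : ℂ)) σ).re + 4 * (LSeries Λ₁ (σ + t * I)).re +
      (LSeries Λ₂ (σ + 2 * t * I)).re
  /-- `F` is holomorphic on `σ > 1 − η`. -/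
  differentiableOn : DifferentiableOn ℂ F {s : ℂ | 1 - η < s.re}
  /-- `F ≠ 0` on `σ > 1`. -/
  ne_zero : ∀ s : ℂ, 1 < s.re → F s ≠ 0
  /-- `F'/F = −L(Λ₁, ·)` on `σ > 1`. -/
  logDeriv_eq : ∀ s : ℂ, 1 < s.re → deriv F s / F s = -LSeries Λ₁ s
  /-- Polynomial growth in `Q` and `t`: `|F(s)| ≤ C_g Q^A (|t|+4)^A` for `1 − η < σ ≤ 3`. -/
  growth : ∀ s : ℂ, 1 - η < s.re → s.re ≤ 3 → ‖F s‖ ≤ Cg * Q ^ A * (|s.im| + 4) ^ A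
  /-- Lower bound to the right of `σ = 1`: `c₁ (σ − 1) ≤ |F(s)|` for `1 < σ ≤ 2`. -/
  lower : ∀ s : ℂ, 1 < s.re → s.re ≤ 2 → c₁ * (s.re - 1) ≤ ‖F s‖
  /-- The companion bound for `Λ₂` (with the pole term iff `pole`). -/
  re_LSeries₂_le : ∀ s : ℂ, 1 < s.re → s.re ≤ 2 →
    (LSeries Λ₂ s).re ≤ (if pole then (1 / (s - 1)).re else 0) +
      C₂ * (Real.log Q + Real.log (|s.im| + 4))
  /-- Reflection symmetry of the zeros in the `pole` (real-character) case. -/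
  reflect : pole = true → ∀ ρ : ℂ, 1 - η < ρ.re → F ρ = 0 → F (conj ρ) = 0

namespace TwistedZFRData

variable {η A Cg c₁ K₀ C₂ : ℝ} {pole : Bool} {Q : ℝ} {Λ₀ : ℕ → ℝ} {Λ₁ Λ₂ : ℕ → ℂ} {F : ℂ → ℂ}

/-- Local notation for the package constant `E(η, A, C_g, c₁) = 8(2A + |log(32C_g/(c₁η))| + 1)/(η/4)`. -/
local notation3 "E[" η "," A "," Cg "," c₁ "]" =>
  (8 * (2 * (A : ℝ) + |Real.log ((Cg : ℝ) / ((c₁ : ℝ) * ((η : ℝ) / 32)))| + 1) / ((η : ℝ) / 4))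

section Package

variable (h : TwistedZFRData η A Cg c₁ K₀ C₂ pole Q Λ₀ Λ₁ Λ₂ F)
include h

/-- A zero of `F` in the half-plane has real part `≤ 1`. [folklore] -/
theorem re_le_one_of_zero {a : ℂ} (ha : F a = 0) : a.re ≤ 1 := by
  by_contra hcon
  exact h.ne_zero a (not_le.1 hcon) ha

/-- `0 ≤ E(η, A, C_g, c₁)`. [folklore] -/
theorem packageConst_nonneg : 0 ≤ E[η, A, Cg, c₁] := by
  have := h.eta_pos
  have := h.A_nonneg
  positivity

/-- **Montgomery–Vaughan Lemma 11.1 for `F`** (Titchmarsh's Lemma α on the disc centred at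
`c = 1 + η/32 + it`, radius `η/4`): the zeros of `F` in `|a − c| ≤ η/4` form a finite set `S` with
multiplicities `m ≥ 1`, and `F'/F(z) = ∑_{a ∈ S} m(a)/(z − a) + ψ(z)` on `|z − c| < η/4` (off the
zeros) with `|ψ(z)| ≤ E (log Q + log(|t| + 4))` for `|z − c| ≤ η/16`, `E = E(η, A, C_g, c₁)`
independent of `Q`, `t` and the datum: `|F| ≤ C_g Q^A (|t|+5)^A` on `|z − c| ≤ η/2` and
`|F(c)| ≥ c₁η/32` give `log(M/|F(c)|) ≤ (2A + |log(32C_g/(c₁η))|)(log Q + log(|t|+4))`.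
[cite: MontgomeryVaughan2007, Lemma 11.1] -/
theorem exists_package (t : ℝ) :
    ∃ (S : Finset ℂ) (m : ℂ → ℕ) (ψ : ℂ → ℂ),
      (∀ a ∈ S, F a = 0 ∧ 0 < m a ∧ ‖a - (1 + η / 32 + t * I)‖ ≤ η / 4) ∧
      (∀ a, F a = 0 → ‖a - (1 + η / 32 + t * I)‖ ≤ η / 4 → a ∈ S) ∧
      (∀ z ∈ ball (1 + η / 32 + t * I) (η / 4), F z ≠ 0 →
        ψ z = deriv F z / F z - ∑ a ∈ S, (m a : ℂ) / (z - a)) ∧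
      (∀ z ∈ closedBall (1 + η / 32 + t * I) (η / 16),
        ‖ψ z‖ ≤ E[η, A, Cg, c₁] * (Real.log Q + Real.log (|t| + 4))) := by
  have hη := h.eta_pos
  have hη1 := h.eta_le_one
  have hA := h.A_nonneg
  have hCg := h.Cg_pos
  have hc₁ := h.c₁_pos
  have hQ := h.one_le_Q
  set R : ℝ := η / 4 with hR
  have hRpos : 0 < R := by positivity
  set g₀ : ℝ := c₁ * (η / 32) with hg₀
  have hg₀pos : 0 < g₀ := by positivity
  set c : ℂ := 1 + η / 32 + t * I with hc
  have hcre : c.re = 1 + η / 32 := by simp [hc]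
  have hcim : c.im = t := by simp [hc]
  -- lower bound at the centre
  have hcentre : g₀ ≤ ‖F c‖ := by
    have h1 := h.lower c (by rw [hcre]; linarith) (by rw [hcre]; linarith)
    rw [hcre] at h1
    rw [hg₀]
    linarith
  have hFc : F c ≠ 0 := norm_pos_iff.1 (hg₀pos.trans_le hcentre)
  -- holomorphy on `ball c η`
  have hdiff : DifferentiableOn ℂ F (ball c η) := by
    refine h.differentiableOn.mono fun z hz ↦ ?_
    simp only [Set.mem_setOf_eq]
    have h1 : |(z - c).re| ≤ ‖z - c‖ := abs_re_le_norm _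
    rw [mem_ball_iff_norm] at hz
    rw [Complex.sub_re, hcre] at h1
    have := neg_abs_le (z.re - (1 + η / 32))
    linarith
  -- the bound `M` on `|z - c| ≤ 2R = η/2`
  set M : ℝ := Cg * Q ^ A * (|t| + 5) ^ A with hM
  have hQA : 1 ≤ Q ^ A := Real.one_le_rpow hQ hA
  have hMpos : 0 < M := by positivity
  have hMbound : ∀ z ∈ closedBall c (2 * R), ‖F z‖ ≤ M := by
    intro z hz
    rw [mem_closedBall_iff_norm] at hz
    have h1 : |(z - c).re| ≤ ‖z - c‖ := abs_re_le_norm _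
    have h2 : |(z - c).im| ≤ ‖z - c‖ := abs_im_le_norm _
    rw [Complex.sub_re, hcre] at h1
    rw [Complex.sub_im, hcim] at h2
    have hre1 : 1 - η < z.re := by
      have := neg_abs_le (z.re - (1 + η / 32)); rw [hR] at hz; linarith
    have hre2 : z.re ≤ 3 := by
      have := le_abs_self (z.re - (1 + η / 32)); rw [hR] at hz; linarith
    refine (h.growth z hre1 hre2).trans ?_
    rw [hM]
    have him : |z.im| + 4 ≤ |t| + 5 := by
      have := abs_sub_abs_le_abs_sub z.im t
      rw [hR] at hz; linarith
    exact mul_le_mul_of_nonneg_left (Real.rpow_le_rpow (by positivity) him hA) (by positivity)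
  obtain ⟨S, m, ψ, hS, hS', -, hψ, hψb, -⟩ :=
    Literature.Analysis.Complex.titchmarsh_logDeriv_sub_sum_of_differentiableOn hdiff
      (by rw [hR]; linarith) hFc hRpos hMbound
  refine ⟨S, m, ψ, ?_, ?_, ?_, fun z hz ↦ ?_⟩
  · simpa only [hR] using hS
  · simpa only [hR] using hS'
  · simpa only [hR] using hψ
  have hz' : z ∈ closedBall c (R / 4) := by rw [hR]; convert hz using 2; ring
  refine (hψb z hz').trans ?_
  -- `log(M/‖F c‖) ≤ (2A + B)(log Q + log(|t| + 4))`, `B = |log(Cg/g₀)|`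
  set B : ℝ := |Real.log (Cg / g₀)| with hB
  set ℒ : ℝ := Real.log Q + Real.log (|t| + 4) with hℒ
  have hℒ1 : 1 ≤ ℒ := TwistedZFR.one_le_ell hQ t
  have hlogQ : 0 ≤ Real.log Q := Real.log_nonneg hQ
  have hτ := ClassicalZFRData.one_le_log_tau t
  have hlogM : Real.log (M / ‖F c‖) ≤ (2 * A + B) * ℒ := by
    have hGc : 0 < ‖F c‖ := hg₀pos.trans_le hcentre
    have hMle : M / ‖F c‖ ≤ Q ^ A * (|t| + 5) ^ A * (Cg / g₀) := by
      rw [hM, div_le_iff₀ hGc]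
      calc Cg * Q ^ A * (|t| + 5) ^ A = Q ^ A * (|t| + 5) ^ A * (Cg / g₀) * g₀ := by field_simp
        _ ≤ Q ^ A * (|t| + 5) ^ A * (Cg / g₀) * ‖F c‖ := by gcongr
    have hMpos' : 0 < M / ‖F c‖ := div_pos hMpos hGc
    calc Real.log (M / ‖F c‖) ≤ Real.log (Q ^ A * (|t| + 5) ^ A * (Cg / g₀)) :=
          Real.log_le_log hMpos' hMle
      _ = A * Real.log Q + A * Real.log (|t| + 5) + Real.log (Cg / g₀) := by
          rw [Real.log_mul (by positivity) (by positivity), Real.log_mul (by positivity) (by positivity),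
            Real.log_rpow (by linarith), Real.log_rpow (by positivity)]
      _ ≤ A * Real.log Q + A * (2 * Real.log (|t| + 4)) + B * 1 := by
          gcongr
          · calc Real.log (|t| + 5) ≤ Real.log (2 * (|t| + 4)) :=
                  Real.log_le_log (by positivity) (by linarith [abs_nonneg t])
              _ ≤ 2 * Real.log (|t| + 4) := ClassicalZFRData.log_two_mul_tau_le t
          · rw [mul_one]; exact le_abs_self _
      _ ≤ (2 * A + B) * ℒ := by
          rw [hℒ]
          have hB0 : 0 ≤ B := abs_nonneg _
          nlinarith
  have hfinal : 8 * (Real.log (M / ‖F c‖) + 1) / R ≤ 8 * (2 * A + B + 1) / R * ℒ := by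
    calc 8 * (Real.log (M / ‖F c‖) + 1) / R ≤ 8 * ((2 * A + B) * ℒ + 1 * ℒ) / R := by
          gcongr; simpa using hℒ1
      _ = 8 * (2 * A + B + 1) / R * ℒ := by ring
  convert hfinal using 2

end Package

/-! ## The basic inequalities (MV (11.2), (11.3)) -/

section Inequalities

variable (h : TwistedZFRData η A Cg c₁ K₀ C₂ pole Q Λ₀ Λ₁ Λ₂ F)
include h

/-- First inequality of MV (11.2): `Re L(Λ₀, 1 + δ) ≤ 1/δ + K₀` for `0 < δ ≤ 1`.
[cite: MontgomeryVaughan2007, Theorem 11.3 (proof, eq. (11.2))] -/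
theorem re_LSeries₀_le_of_pos {d : ℝ} (hd : 0 < d) (hd1 : d ≤ 1) :
    (LSeries (fun n ↦ (Λ₀ n : ℂ)) ((1 + d : ℝ) : ℂ)).re ≤ 1 / d + K₀ := by
  have := h.re_LSeries₀_le (1 + d) (by linarith) (by linarith)
  rwa [show (1 + d : ℝ) - 1 = d by ring] at this

/-- The companion bound with the pole term always allowed:
`Re L(Λ₂, s) ≤ Re 1/(s−1) + C₂(log Q + log(|t|+4))` for `1 < σ ≤ 2` (if `pole = false` the
hypothesis is stronger, `Re 1/(s − 1) ≥ 0`). [folklore] -/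
theorem re_LSeries₂_le_pole (s : ℂ) (hs : 1 < s.re) (hs2 : s.re ≤ 2) :
    (LSeries Λ₂ s).re ≤ (1 / (s - 1)).re + C₂ * (Real.log Q + Real.log (|s.im| + 4)) := by
  have h1 := h.re_LSeries₂_le s hs hs2
  have hpos : 0 ≤ (1 / (s - 1)).re := by
    rw [one_div, Complex.inv_re]
    exact div_nonneg (by simp; linarith) (Complex.normSq_nonneg _)
  cases pole
  · simp only [Bool.false_eq_true, ↓reduceIte, zero_add] at h1; linarith
  · simpa using h1

/-- The companion bound without pole (`pole = false`):
`Re L(Λ₂, s) ≤ C₂(log Q + log(|t|+4))` for `1 < σ ≤ 2`. [folklore] -/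
theorem re_LSeries₂_le_noPole (hpole : pole = false) (s : ℂ) (hs : 1 < s.re) (hs2 : s.re ≤ 2) :
    (LSeries Λ₂ s).re ≤ C₂ * (Real.log Q + Real.log (|s.im| + 4)) := by
  have h1 := h.re_LSeries₂_le s hs hs2
  subst hpole
  simpa using h1

/-- Second inequality of MV (11.2): if `β + iγ` is a zero of `F` with `β ≥ 1 − 7η/32`, then for
`0 < δ ≤ 3η/32`, `Re L(Λ₁, 1 + δ + iγ) = −Re F'/F(1+δ+iγ) ≤ E(log Q + log(|γ|+4)) − 1/(1 + δ − β)`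
(package at height `γ`: every `Re 1/(s₀ − a)` is non-negative and the zero itself contributes
`1/(1 + δ − β)`). [cite: MontgomeryVaughan2007, Theorem 11.3 (proof, eq. (11.2))] -/
theorem re_LSeries₁_le_of_zero {E : ℝ}
    (hpack : ∀ t : ℝ, ∃ (S : Finset ℂ) (m : ℂ → ℕ) (ψ : ℂ → ℂ),
      (∀ a ∈ S, F a = 0 ∧ 0 < m a ∧ ‖a - (1 + η / 32 + t * I)‖ ≤ η / 4) ∧
      (∀ a, F a = 0 → ‖a - (1 + η / 32 + t * I)‖ ≤ η / 4 → a ∈ S) ∧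
      (∀ z ∈ ball (1 + η / 32 + t * I) (η / 4), F z ≠ 0 →
        ψ z = deriv F z / F z - ∑ a ∈ S, (m a : ℂ) / (z - a)) ∧
      (∀ z ∈ closedBall (1 + η / 32 + t * I) (η / 16),
        ‖ψ z‖ ≤ E * (Real.log Q + Real.log (|t| + 4))))
    {β γ d : ℝ} (hzero : F (β + γ * I) = 0) (hβ : 1 - 7 * η / 32 ≤ β) (hd : 0 < d)
    (hd1 : d ≤ 3 * η / 32) :
    (LSeries Λ₁ (((1 + d : ℝ) : ℂ) + γ * I)).re ≤
      E * (Real.log Q + Real.log (|γ| + 4)) - 1 / (1 + d - β) := by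
  have hη := h.eta_pos
  obtain ⟨S, m, ψ, hS, hS', hψ, hψb⟩ := hpack γ
  set s₀ : ℂ := ((1 + d : ℝ) : ℂ) + γ * I with hs₀
  have hs₀re : s₀.re = 1 + d := by simp [hs₀]
  have hs₀1 : 1 < s₀.re := by rw [hs₀re]; linarith
  have hβ1 : β ≤ 1 := by
    have := h.re_le_one_of_zero hzero; simpa using this
  set c : ℂ := 1 + η / 32 + γ * I with hcdef
  have hs₀c : ‖s₀ - c‖ ≤ η / 16 := by
    have : s₀ - c = ((d - η / 32 : ℝ) : ℂ) := by simp only [hs₀, hcdef]; push_cast; ring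
    rw [this, Complex.norm_real, Real.norm_eq_abs, abs_le]
    constructor <;> linarith
  have hs₀ball : s₀ ∈ ball c (η / 4) := mem_ball_iff_norm.2 (by linarith)
  have hs₀cl : s₀ ∈ closedBall c (η / 16) := mem_closedBall_iff_norm.2 hs₀c
  have hFs₀ : F s₀ ≠ 0 := h.ne_zero s₀ hs₀1
  have hψs₀ := hψ s₀ hs₀ball hFs₀
  -- `ρ = β + iγ ∈ S`
  set ρ : ℂ := β + γ * I with hρ
  have hρS : ρ ∈ S := by
    refine hS' ρ hzero ?_
    have : ρ - c = ((β - 1 - η / 32 : ℝ) : ℂ) := by simp only [hρ, hcdef]; push_cast; ring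
    rw [this, Complex.norm_real, Real.norm_eq_abs, abs_le]
    constructor <;> linarith
  have hSre : ∀ a ∈ S, a.re < s₀.re := by
    intro a ha
    have := h.re_le_one_of_zero (hS a ha).1
    rw [hs₀re]; linarith
  obtain ⟨-, hge⟩ := ClassicalZFRData.re_sum_div_ge (m := m) hSre
  have hρterm : ((s₀ - ρ)⁻¹).re = 1 / (1 + d - β) := by
    have : s₀ - ρ = ((1 + d - β : ℝ) : ℂ) := by simp only [hs₀, hρ]; push_cast; ring
    rw [this, ← Complex.ofReal_inv, Complex.ofReal_re, one_div]
  have hsum_ge := hge ρ hρS (hS ρ hρS).2.1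
  rw [hρterm] at hsum_ge
  -- `Re L(Λ₁, s₀) = −Re (ψ(s₀) + ∑)`
  have hL : LSeries Λ₁ s₀ = -(ψ s₀ + ∑ a ∈ S, (m a : ℂ) / (s₀ - a)) := by
    rw [hψs₀, h.logDeriv_eq s₀ hs₀1]; ring
  rw [hL, Complex.neg_re, Complex.add_re]
  have := (Complex.abs_re_le_norm (ψ s₀)).trans (hψb s₀ hs₀cl)
  linarith [neg_abs_le (ψ s₀).re, le_abs_self (ψ s₀).re]

/-- Third inequality of MV (11.2) (no zero needed): for `0 < δ ≤ 3η/32` and real `t`,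
`Re L(Λ₁, 1 + δ + it) ≤ E (log Q + log(|t| + 4))`.
[cite: MontgomeryVaughan2007, Theorem 11.3 (proof, eq. (11.2))] -/
theorem re_LSeries₁_le {E : ℝ}
    (hpack : ∀ t : ℝ, ∃ (S : Finset ℂ) (m : ℂ → ℕ) (ψ : ℂ → ℂ),
      (∀ a ∈ S, F a = 0 ∧ 0 < m a ∧ ‖a - (1 + η / 32 + t * I)‖ ≤ η / 4) ∧
      (∀ a, F a = 0 → ‖a - (1 + η / 32 + t * I)‖ ≤ η / 4 → a ∈ S) ∧
      (∀ z ∈ ball (1 + η / 32 + t * I) (η / 4), F z ≠ 0 →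
        ψ z = deriv F z / F z - ∑ a ∈ S, (m a : ℂ) / (z - a)) ∧
      (∀ z ∈ closedBall (1 + η / 32 + t * I) (η / 16),
        ‖ψ z‖ ≤ E * (Real.log Q + Real.log (|t| + 4))))
    {d : ℝ} (hd : 0 < d) (hd1 : d ≤ 3 * η / 32) (t : ℝ) :
    (LSeries Λ₁ (((1 + d : ℝ) : ℂ) + t * I)).re ≤ E * (Real.log Q + Real.log (|t| + 4)) := by
  have hη := h.eta_pos
  obtain ⟨S, m, ψ, hS, -, hψ, hψb⟩ := hpack t
  set s₀ : ℂ := ((1 + d : ℝ) : ℂ) + t * I with hs₀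
  have hs₀re : s₀.re = 1 + d := by simp [hs₀]
  have hs₀1 : 1 < s₀.re := by rw [hs₀re]; linarith
  set c : ℂ := 1 + η / 32 + t * I with hcdef
  have hs₀c : ‖s₀ - c‖ ≤ η / 16 := by
    have : s₀ - c = ((d - η / 32 : ℝ) : ℂ) := by simp only [hs₀, hcdef]; push_cast; ring
    rw [this, Complex.norm_real, Real.norm_eq_abs, abs_le]
    constructor <;> linarith
  have hs₀ball : s₀ ∈ ball c (η / 4) := mem_ball_iff_norm.2 (by linarith)
  have hs₀cl : s₀ ∈ closedBall c (η / 16) := mem_closedBall_iff_norm.2 hs₀c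
  have hFs₀ : F s₀ ≠ 0 := h.ne_zero s₀ hs₀1
  have hψs₀ := hψ s₀ hs₀ball hFs₀
  have hSre : ∀ a ∈ S, a.re < s₀.re := by
    intro a ha
    have := h.re_le_one_of_zero (hS a ha).1
    rw [hs₀re]; linarith
  obtain ⟨hnn, -⟩ := ClassicalZFRData.re_sum_div_ge (m := m) hSre
  have hL : LSeries Λ₁ s₀ = -(ψ s₀ + ∑ a ∈ S, (m a : ℂ) / (s₀ - a)) := by
    rw [hψs₀, h.logDeriv_eq s₀ hs₀1]; ring
  rw [hL, Complex.neg_re, Complex.add_re]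
  have := (Complex.abs_re_le_norm (ψ s₀)).trans (hψb s₀ hs₀cl)
  linarith [neg_abs_le (ψ s₀).re, le_abs_self (ψ s₀).re]

/-- **Case 3 input** (MV (11.3)): in the `pole` case, for a zero `β + iγ` with `γ ≠ 0` and
`|(β + iγ) − (1 + η/32)| ≤ η/4`, and `0 < δ ≤ 3η/32`,
`Re L(Λ₁, 1 + δ) ≤ E(log Q + log 4) − 2(1+δ−β)/((1+δ−β)² + γ²)`, the zeros `β ± iγ` (reflection)
both lying in the disc at height `0`. [cite: MontgomeryVaughan2007, Theorem 11.3 (proof, Case 3, eq. (11.3))] -/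
theorem re_LSeries₁_real_le_of_pair (hpole : pole = true) {E : ℝ}
    (hpack : ∀ t : ℝ, ∃ (S : Finset ℂ) (m : ℂ → ℕ) (ψ : ℂ → ℂ),
      (∀ a ∈ S, F a = 0 ∧ 0 < m a ∧ ‖a - (1 + η / 32 + t * I)‖ ≤ η / 4) ∧
      (∀ a, F a = 0 → ‖a - (1 + η / 32 + t * I)‖ ≤ η / 4 → a ∈ S) ∧
      (∀ z ∈ ball (1 + η / 32 + t * I) (η / 4), F z ≠ 0 →
        ψ z = deriv F z / F z - ∑ a ∈ S, (m a : ℂ) / (z - a)) ∧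
      (∀ z ∈ closedBall (1 + η / 32 + t * I) (η / 16),
        ‖ψ z‖ ≤ E * (Real.log Q + Real.log (|t| + 4))))
    {β γ d : ℝ} (hzero : F (β + γ * I) = 0) (hγ : γ ≠ 0)
    (hnear : ‖(β + γ * I : ℂ) - (1 + η / 32)‖ ≤ η / 4) (hd : 0 < d) (hd1 : d ≤ 3 * η / 32) :
    (LSeries Λ₁ ((1 + d : ℝ) : ℂ)).re ≤
      E * (Real.log Q + Real.log (|(0 : ℝ)| + 4)) -
        2 * ((1 + d - β) / ((1 + d - β) ^ 2 + γ ^ 2)) := by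
  have hη := h.eta_pos
  obtain ⟨S, m, ψ, hS, hS', hψ, hψb⟩ := hpack 0
  set c : ℂ := 1 + η / 32 + ((0 : ℝ) : ℂ) * I with hcdef
  have hc : c = 1 + η / 32 := by simp [hcdef]
  set s₀ : ℂ := ((1 + d : ℝ) : ℂ) with hs₀
  have hs₀re : s₀.re = 1 + d := by simp [hs₀]
  have hs₀1 : 1 < s₀.re := by rw [hs₀re]; linarith
  have hs₀c : ‖s₀ - c‖ ≤ η / 16 := by
    have : s₀ - c = ((d - η / 32 : ℝ) : ℂ) := by rw [hc, hs₀]; push_cast; ring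
    rw [this, Complex.norm_real, Real.norm_eq_abs, abs_le]
    constructor <;> linarith
  have hs₀ball : s₀ ∈ ball c (η / 4) := mem_ball_iff_norm.2 (by linarith)
  have hs₀cl : s₀ ∈ closedBall c (η / 16) := mem_closedBall_iff_norm.2 hs₀c
  have hFs₀ : F s₀ ≠ 0 := h.ne_zero s₀ hs₀1
  have hψs₀ := hψ s₀ hs₀ball hFs₀
  -- the two zeros
  set ρ₁ : ℂ := β + γ * I with hρ₁
  set ρ₂ : ℂ := conj ρ₁ with hρ₂
  have hρ₂eq : ρ₂ = β - γ * I := by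
    rw [hρ₂, hρ₁, map_add, map_mul, Complex.conj_ofReal, Complex.conj_ofReal, Complex.conj_I]
    ring
  have hρ₁re : 1 - η < ρ₁.re := by
    have h1 : |(ρ₁ - (1 + η / 32)).re| ≤ ‖ρ₁ - (1 + η / 32)‖ := Complex.abs_re_le_norm _
    have hre : (ρ₁ - (1 + η / 32)).re = β - (1 + η / 32) := by simp [hρ₁]
    rw [hre] at h1
    have := neg_abs_le (β - (1 + η / 32))
    have hb : ρ₁.re = β := by simp [hρ₁]
    rw [hb]; linarith
  have hzero₂ : F ρ₂ = 0 := h.reflect hpole ρ₁ hρ₁re hzero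
  have hρ₁S : ρ₁ ∈ S := hS' ρ₁ hzero (by rw [hc]; exact hnear)
  have hρ₂S : ρ₂ ∈ S := by
    refine hS' ρ₂ hzero₂ ?_
    rw [hc, hρ₂]
    have : (1 + (η : ℂ) / 32) = conj (1 + (η : ℂ) / 32) := by
      simp [map_div₀, map_ofNat, Complex.conj_ofReal]
    rw [this, ← map_sub, Complex.norm_conj]
    exact hnear
  have hne : ρ₁ ≠ ρ₂ := by
    intro h'
    have := congrArg Complex.im h'
    rw [hρ₂eq, hρ₁] at this
    simp at this
    exact hγ (by linarith)
  have hSre : ∀ a ∈ S, a.re < s₀.re := by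
    intro a ha
    have := h.re_le_one_of_zero (hS a ha).1
    rw [hs₀re]; linarith
  have hpair := DirichletZFR.re_sum_div_ge_pair hSre (fun a ha ↦ (hS a ha).2.1) hρ₁S hρ₂S hne
  have h₁ : ((s₀ - ρ₁)⁻¹).re = (1 + d - β) / ((1 + d - β) ^ 2 + γ ^ 2) := by
    have : s₀ - ρ₁ = ((1 + d - β : ℝ) : ℂ) + ((-γ : ℝ) : ℂ) * I := by
      rw [hs₀, hρ₁]; push_cast; ring
    rw [this, DirichletZFR.re_inv_ofReal_add_mul_I]; ring
  have h₂ : ((s₀ - ρ₂)⁻¹).re = (1 + d - β) / ((1 + d - β) ^ 2 + γ ^ 2) := by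
    have : s₀ - ρ₂ = ((1 + d - β : ℝ) : ℂ) + ((γ : ℝ) : ℂ) * I := by
      rw [hs₀, hρ₂eq]; push_cast; ring
    rw [this, DirichletZFR.re_inv_ofReal_add_mul_I]
  rw [h₁, h₂] at hpair
  have hL : LSeries Λ₁ s₀ = -(ψ s₀ + ∑ a ∈ S, (m a : ℂ) / (s₀ - a)) := by
    rw [hψs₀, h.logDeriv_eq s₀ hs₀1]; ring
  rw [hL, Complex.neg_re, Complex.add_re]
  have hψn := (Complex.abs_re_le_norm (ψ s₀)).trans (hψb s₀ hs₀cl)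
  have hψre : -(ψ s₀).re ≤ E * (Real.log Q + Real.log (|(0 : ℝ)| + 4)) := by
    linarith [neg_abs_le (ψ s₀).re]
  have hsum : 2 * ((1 + d - β) / ((1 + d - β) ^ 2 + γ ^ 2)) ≤
      (∑ a ∈ S, (m a : ℂ) / (s₀ - a)).re := by linarith [hpair]
  linear_combination hψre + hsum

/-- The companion bound at `1 + δ + iu` with the pole term evaluated:
`Re L(Λ₂, 1 + δ + iu) ≤ δ/(δ² + u²) + C₂(log Q + log(|u| + 4))` for `0 < δ ≤ 1`.
[cite: MontgomeryVaughan2007, Theorem 11.3 (proof, Case 2)] -/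
theorem re_LSeries₂_le_of_pos {d : ℝ} (hd : 0 < d) (hd1 : d ≤ 1) (u : ℝ) :
    (LSeries Λ₂ (((1 + d : ℝ) : ℂ) + u * I)).re ≤
      d / (d ^ 2 + u ^ 2) + C₂ * (Real.log Q + Real.log (|u| + 4)) := by
  set s : ℂ := ((1 + d : ℝ) : ℂ) + u * I with hs
  have hsre : s.re = 1 + d := by simp [hs]
  have hsim : s.im = u := by simp [hs]
  have h1 := h.re_LSeries₂_le_pole s (by rw [hsre]; linarith) (by rw [hsre]; linarith)
  rw [hsim] at h1
  have h2 : (1 / (s - 1)).re = d / (d ^ 2 + u ^ 2) := by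
    have : s - 1 = ((d : ℝ) : ℂ) + ((u : ℝ) : ℂ) * I := by rw [hs]; push_cast; ring
    rw [one_div, this, DirichletZFR.re_inv_ofReal_add_mul_I]
  linarith

end Inequalities

/-! ## The cases of the proof of MV Theorem 11.3 -/

section Cases

variable (h : TwistedZFRData η A Cg c₁ K₀ C₂ pole Q Λ₀ Λ₁ Λ₂ F)
include h

/-- **A zero on the line `σ = 1` off the real axis is impossible** (this replaces the input
"`L(1 + it, χ) ≠ 0`", not assumed here): if `F(1 + iγ) = 0` with `γ ≠ 0`, then `3-4-1` at
`σ = 1 + δ` gives `1/δ ≤ 3K₀ + (4E + 2C₂)ℒ + 1/(4|γ|)` for every small `δ > 0`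
(`δ/(δ² + 4γ²) ≤ 1/(4|γ|)`), which fails for `δ` small. [cite: MontgomeryVaughan2007, Theorem 11.3 (proof)] -/
theorem not_zero_of_re_eq_one {E : ℝ} (hE : 0 ≤ E)
    (hpack : ∀ t : ℝ, ∃ (S : Finset ℂ) (m : ℂ → ℕ) (ψ : ℂ → ℂ),
      (∀ a ∈ S, F a = 0 ∧ 0 < m a ∧ ‖a - (1 + η / 32 + t * I)‖ ≤ η / 4) ∧
      (∀ a, F a = 0 → ‖a - (1 + η / 32 + t * I)‖ ≤ η / 4 → a ∈ S) ∧
      (∀ z ∈ ball (1 + η / 32 + t * I) (η / 4), F z ≠ 0 →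
        ψ z = deriv F z / F z - ∑ a ∈ S, (m a : ℂ) / (z - a)) ∧
      (∀ z ∈ closedBall (1 + η / 32 + t * I) (η / 16),
        ‖ψ z‖ ≤ E * (Real.log Q + Real.log (|t| + 4))))
    {β γ : ℝ} (hzero : F (β + γ * I) = 0) (hβ : β = 1) (hγ : γ ≠ 0) : False := by
  have hη := h.eta_pos
  have hη1 := h.eta_le_one
  have hK₀ := h.K₀_nonneg
  have hC₂ := h.C₂_nonneg
  have hQ := h.one_le_Q
  set ℒ : ℝ := Real.log Q + Real.log (|γ| + 4) with hℒ
  have hℒ1 : 1 ≤ ℒ := TwistedZFR.one_le_ell hQ γ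
  have hγ0 : 0 < |γ| := abs_pos.2 hγ
  obtain ⟨X, hX⟩ : ∃ X : ℝ, X = 3 * K₀ + 4 * (E * ℒ) + 2 * C₂ * ℒ + 1 / (4 * |γ|) := ⟨_, rfl⟩
  have hX0 : 0 ≤ X := by rw [hX]; positivity
  have h32 : 0 < 32 / (3 * η) := by positivity
  obtain ⟨d, hddef⟩ : ∃ d : ℝ, d = 1 / (X + 32 / (3 * η) + 1) := ⟨_, rfl⟩
  have hden : 0 < X + 32 / (3 * η) + 1 := by positivity
  have hdpos : 0 < d := by rw [hddef]; positivity
  have hd_inv : 1 / d = X + 32 / (3 * η) + 1 := by rw [hddef, one_div_one_div]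
  have hd1 : d ≤ 3 * η / 32 := by
    have h1 : d ≤ 1 / (32 / (3 * η)) := by
      rw [hddef]
      exact div_le_div_of_nonneg_left zero_le_one h32 (by linarith)
    rw [one_div_div] at h1
    linarith
  have hd1' : d ≤ 1 := by linarith
  -- the three inequalities at `σ = 1 + d`
  have hA := h.re_LSeries₀_le_of_pos hdpos hd1'
  have hB := h.re_LSeries₁_le_of_zero hpack hzero (by rw [hβ]; linarith) hdpos hd1
  rw [hβ, show 1 + d - (1 : ℝ) = d by ring] at hB
  have hC := h.re_LSeries₂_le_of_pos hdpos hd1' (2 * γ)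
  have h341 := h.three_four_one (1 + d) (by linarith) γ
  have hpt : ((1 + d : ℝ) : ℂ) + 2 * γ * I = ((1 + d : ℝ) : ℂ) + ((2 * γ : ℝ) : ℂ) * I := by
    push_cast; ring
  rw [hpt] at h341
  -- the pole term `d/(d² + 4γ²) ≤ 1/(4|γ|)`
  have hpole : d / (d ^ 2 + (2 * γ) ^ 2) ≤ 1 / (4 * |γ|) := by
    rw [div_le_div_iff₀ (by positivity) (by positivity)]
    have hsq : (2 * γ) ^ 2 = 4 * |γ| ^ 2 := by rw [mul_pow, sq_abs]; norm_num
    rw [hsq]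
    nlinarith [sq_nonneg (d - 2 * |γ|)]
  have h2 := TwistedZFR.ell_two_mul_le hQ γ
  have hC' : (LSeries Λ₂ (((1 + d : ℝ) : ℂ) + ((2 * γ : ℝ) : ℂ) * I)).re ≤
      1 / (4 * |γ|) + 2 * C₂ * ℒ := by
    refine hC.trans ?_
    have : C₂ * (Real.log Q + Real.log (|2 * γ| + 4)) ≤ C₂ * (2 * ℒ) :=
      mul_le_mul_of_nonneg_left h2 hC₂
    linarith
  -- combine: `1/d ≤ X`
  have hkey : 1 / d ≤ 3 * K₀ + 4 * (E * ℒ) + 2 * C₂ * ℒ + 1 / (4 * |γ|) := by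
    linear_combination h341 + 3 * hA + 4 * hB + hC'
  rw [hd_inv, ← hX] at hkey
  linarith

/-- **Case 1 of MV Theorem 11.3** (no pole, e.g. complex `ν²`): a zero `β + iγ` of `F` with
`β ≥ 1 − 7η/32` satisfies `1 − β ≥ 1/(14 E₁ ℒ)`, `ℒ = log Q + log(|γ| + 4)`,
`E₁ = 3K₀ + 4E + 2C₂ + 6/η`: from `3-4-1` and (11.2), `4/(1 + δ − β) ≤ 3/δ + E₁ ℒ`, and
`δ = 1/(2E₁ℒ) (≤ 3η/32)` gives the claim. [cite: MontgomeryVaughan2007, Theorem 11.3 (proof, Case 1)] -/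
theorem one_sub_re_ge_of_noPole (hpole : pole = false) {E : ℝ} (hE : 0 ≤ E)
    (hpack : ∀ t : ℝ, ∃ (S : Finset ℂ) (m : ℂ → ℕ) (ψ : ℂ → ℂ),
      (∀ a ∈ S, F a = 0 ∧ 0 < m a ∧ ‖a - (1 + η / 32 + t * I)‖ ≤ η / 4) ∧
      (∀ a, F a = 0 → ‖a - (1 + η / 32 + t * I)‖ ≤ η / 4 → a ∈ S) ∧
      (∀ z ∈ ball (1 + η / 32 + t * I) (η / 4), F z ≠ 0 →
        ψ z = deriv F z / F z - ∑ a ∈ S, (m a : ℂ) / (z - a)) ∧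
      (∀ z ∈ closedBall (1 + η / 32 + t * I) (η / 16),
        ‖ψ z‖ ≤ E * (Real.log Q + Real.log (|t| + 4))))
    {β γ : ℝ} (hzero : F (β + γ * I) = 0) (hβ : 1 - 7 * η / 32 ≤ β) :
    1 / (14 * (3 * K₀ + 4 * E + 2 * C₂ + 6 / η) * (Real.log Q + Real.log (|γ| + 4))) ≤ 1 - β := by
  have hη := h.eta_pos
  have hη1 := h.eta_le_one
  have hK₀ := h.K₀_nonneg
  have hC₂ := h.C₂_nonneg
  have hQ := h.one_le_Q
  set E₁ : ℝ := 3 * K₀ + 4 * E + 2 * C₂ + 6 / η with hE₁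
  have hℒ1 : 1 ≤ Real.log Q + Real.log (|γ| + 4) := TwistedZFR.one_le_ell hQ γ
  have hℒ0 : 0 < Real.log Q + Real.log (|γ| + 4) := by linarith
  have h6η : 6 ≤ 6 / η := by rw [le_div_iff₀ hη]; nlinarith
  have hE₁6 : 6 / η ≤ E₁ := by rw [hE₁]; linarith
  have h6pos : 0 < 6 / η := by positivity
  have hE₁0 : 0 < E₁ := by linarith
  have hβ1 : β ≤ 1 := by have := h.re_le_one_of_zero hzero; simpa using this
  -- `δ = 1/(2 E₁ ℒ)`
  set d : ℝ := 1 / (2 * E₁ * (Real.log Q + Real.log (|γ| + 4))) with hddef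
  have hdpos : 0 < d := by positivity
  have hd1 : d ≤ 3 * η / 32 := by
    have h1 : d ≤ 1 / (2 * E₁) := by
      rw [hddef]; exact div_le_div_of_nonneg_left zero_le_one (by positivity) (by nlinarith)
    have h2 : 1 / (2 * E₁) ≤ 1 / (2 * (6 / η)) :=
      div_le_div_of_nonneg_left zero_le_one (by positivity) (by linarith)
    have h3 : 1 / (2 * (6 / η)) = η / 12 := by field_simp; ring
    linarith
  have hd1' : d ≤ 1 := by linarith
  -- the three inequalities
  have hA := h.re_LSeries₀_le_of_pos hdpos hd1'
  have hB := h.re_LSeries₁_le_of_zero hpack hzero hβ hdpos hd1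
  have hC := h.re_LSeries₂_le_noPole hpole (((1 + d : ℝ) : ℂ) + ((2 * γ : ℝ) : ℂ) * I)
    (by simp; linarith) (by simp; linarith)
  have h341 := h.three_four_one (1 + d) (by linarith) γ
  have hpt : ((1 + d : ℝ) : ℂ) + 2 * γ * I = ((1 + d : ℝ) : ℂ) + ((2 * γ : ℝ) : ℂ) * I := by
    push_cast; ring
  rw [hpt] at h341
  have h2 := TwistedZFR.ell_two_mul_le hQ γ
  set ℒ : ℝ := Real.log Q + Real.log (|γ| + 4) with hℒ
  have hC' : (LSeries Λ₂ (((1 + d : ℝ) : ℂ) + ((2 * γ : ℝ) : ℂ) * I)).re ≤ 2 * C₂ * ℒ := by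
    refine hC.trans ?_
    have him : (((1 + d : ℝ) : ℂ) + ((2 * γ : ℝ) : ℂ) * I).im = 2 * γ := by simp
    rw [him]
    calc C₂ * (Real.log Q + Real.log (|2 * γ| + 4)) ≤ C₂ * (2 * ℒ) := by gcongr
      _ = 2 * C₂ * ℒ := by ring
  -- `4/(1+δ−β) ≤ 3/δ + (3K₀ + 4E + 2C₂)ℒ ≤ 7 E₁ ℒ`
  have hkey : 4 / (1 + d - β) ≤ 7 * E₁ * ℒ := by
    have h3d : 3 / d = 6 * E₁ * ℒ := by rw [hddef]; field_simp; norm_num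
    have hK₀ℒ : K₀ ≤ K₀ * ℒ := by nlinarith
    have h6 : 4 / (1 + d - β) ≤ 3 / d + 3 * K₀ + 4 * (E * ℒ) + 2 * C₂ * ℒ := by
      linear_combination h341 + 3 * hA + 4 * hB + hC'
    have h7 : 3 * K₀ + 4 * (E * ℒ) + 2 * C₂ * ℒ ≤ E₁ * ℒ := by
      rw [hE₁]
      have : 0 ≤ 6 / η * ℒ := by positivity
      nlinarith
    linarith
  -- conclude
  have hpos : 0 < 1 + d - β := by linarith
  have hgap : 4 / (7 * E₁ * ℒ) ≤ 1 + d - β := by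
    rw [div_le_iff₀ (by positivity)]
    rw [div_le_iff₀ hpos] at hkey
    linarith
  have : 1 / (14 * E₁ * ℒ) = 4 / (7 * E₁ * ℒ) - d := by rw [hddef]; field_simp; norm_num
  linarith

/-- **Case 2 of MV Theorem 11.3** (`pole`, `|γ| ≥ 6(1 − β)`): a zero `β + iγ` of `F` with
`0 < 1 − β ≤ η/64` and `|γ| ≥ 6(1 − β)` satisfies `1 − β ≥ 4/(105 E₂ ℒ)`,
`E₂ = 3K₀ + 4E + 2C₂ + 1`: with `δ = 6(1 − β)` the pole term is `δ/(δ² + 4γ²) ≤ 1/(30(1−β))`, and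
`3/6 − 4/7 + 1/30 = −4/105`. [cite: MontgomeryVaughan2007, Theorem 11.3 (proof, Case 2)] -/
theorem one_sub_re_ge_of_pole_far {E : ℝ} (hE : 0 ≤ E)
    (hpack : ∀ t : ℝ, ∃ (S : Finset ℂ) (m : ℂ → ℕ) (ψ : ℂ → ℂ),
      (∀ a ∈ S, F a = 0 ∧ 0 < m a ∧ ‖a - (1 + η / 32 + t * I)‖ ≤ η / 4) ∧
      (∀ a, F a = 0 → ‖a - (1 + η / 32 + t * I)‖ ≤ η / 4 → a ∈ S) ∧
      (∀ z ∈ ball (1 + η / 32 + t * I) (η / 4), F z ≠ 0 →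
        ψ z = deriv F z / F z - ∑ a ∈ S, (m a : ℂ) / (z - a)) ∧
      (∀ z ∈ closedBall (1 + η / 32 + t * I) (η / 16),
        ‖ψ z‖ ≤ E * (Real.log Q + Real.log (|t| + 4))))
    {β γ : ℝ} (hzero : F (β + γ * I) = 0) (hβ1 : β < 1)
    (hsmall : 1 - β ≤ η / 64) (hfar : 6 * (1 - β) ≤ |γ|) :
    4 / (105 * (3 * K₀ + 4 * E + 2 * C₂ + 1) * (Real.log Q + Real.log (|γ| + 4))) ≤ 1 - β := by
  have hη := h.eta_pos
  have hη1 := h.eta_le_one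
  have hK₀ := h.K₀_nonneg
  have hC₂ := h.C₂_nonneg
  have hQ := h.one_le_Q
  have hℒ1 : 1 ≤ Real.log Q + Real.log (|γ| + 4) := TwistedZFR.one_le_ell hQ γ
  set u : ℝ := 1 - β with hu
  have hu0 : 0 < u := by rw [hu]; linarith
  set d : ℝ := 6 * u with hddef
  have hdpos : 0 < d := by positivity
  have hd1 : d ≤ 3 * η / 32 := by rw [hddef]; linarith
  have hd1' : d ≤ 1 := by linarith
  have hβ : 1 - 7 * η / 32 ≤ β := by linarith
  -- the three inequalities
  have hA := h.re_LSeries₀_le_of_pos hdpos hd1'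
  have hB := h.re_LSeries₁_le_of_zero hpack hzero hβ hdpos hd1
  have hCζ := h.re_LSeries₂_le_of_pos hdpos hd1' (2 * γ)
  have h341 := h.three_four_one (1 + d) (by linarith) γ
  have hpt : ((1 + d : ℝ) : ℂ) + 2 * γ * I = ((1 + d : ℝ) : ℂ) + ((2 * γ : ℝ) : ℂ) * I := by
    push_cast; ring
  rw [hpt] at h341
  have h2 := TwistedZFR.ell_two_mul_le hQ γ
  set ℒ : ℝ := Real.log Q + Real.log (|γ| + 4) with hℒ
  have hℒ0 : 0 < ℒ := by linarith
  -- the pole term `δ/(δ² + 4γ²) ≤ 1/(30 u)`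
  have hγ2 : 36 * u ^ 2 ≤ γ ^ 2 := by
    have h6u : 0 ≤ 6 * u := by positivity
    have := mul_le_mul hfar hfar h6u (abs_nonneg γ)
    rw [← pow_two, ← pow_two, sq_abs] at this
    nlinarith
  have hpole : d / (d ^ 2 + (2 * γ) ^ 2) ≤ 1 / (30 * u) := by
    rw [div_le_div_iff₀ (by positivity) (by positivity), hddef]
    nlinarith
  have hC' : (LSeries Λ₂ (((1 + d : ℝ) : ℂ) + ((2 * γ : ℝ) : ℂ) * I)).re ≤
      1 / (30 * u) + 2 * C₂ * ℒ := by
    refine hCζ.trans ?_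
    have : C₂ * (Real.log Q + Real.log (|2 * γ| + 4)) ≤ C₂ * (2 * ℒ) :=
      mul_le_mul_of_nonneg_left h2 hC₂
    linarith
  -- combine: `(4/105)/u ≤ 3K₀ + (4E + 2C₂)ℒ ≤ E₂ ℒ`
  have h1d : 1 / d = 1 / (6 * u) := by rw [hddef]
  have h1β : 1 / (1 + d - β) = 1 / (7 * u) := by rw [hddef, hu]; ring_nf
  rw [h1d] at hA
  rw [h1β] at hB
  have hkey : (4 / 105) / u ≤ 3 * K₀ + 4 * (E * ℒ) + 2 * C₂ * ℒ := by
    have e : (4 / 105) / u = -(3 * (1 / (6 * u)) - 4 * (1 / (7 * u)) + 1 / (30 * u)) := by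
      field_simp; norm_num
    rw [e]
    linear_combination h341 + 3 * hA + 4 * hB + hC'
  set E₂ : ℝ := 3 * K₀ + 4 * E + 2 * C₂ + 1 with hE₂
  have hE₂0 : 0 < E₂ := by rw [hE₂]; positivity
  have hkey2 : (4 / 105) / u ≤ E₂ * ℒ := by
    have : 3 * K₀ + 4 * (E * ℒ) + 2 * C₂ * ℒ ≤ E₂ * ℒ := by rw [hE₂]; nlinarith
    linarith
  rw [div_le_iff₀ (by positivity)]
  rw [div_le_iff₀ hu0] at hkey2
  nlinarith

/-- **Case 3 of MV Theorem 11.3** (`pole`, `0 < |γ| < 6(1 − β)`): a zero `β + iγ` of `F` with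
`γ ≠ 0`, `|γ| < 6(1 − β)` and `0 < 1 − β ≤ 3η/416` satisfies `1 − β ≥ 33/(754 E₃ (log Q + log 4))`,
`E₃ = K₀ + E + 1`: at `σ = 1 + 13(1 − β)` the conjugate pair contributes
`2(σ−β)/((σ−β)² + γ²) ≥ 7/(58(1−β))` in (11.3)–(11.4), and `1/13 − 7/58 = −33/754`.
[cite: MontgomeryVaughan2007, Theorem 11.3 (proof, Case 3)] -/
theorem one_sub_re_ge_of_pole_near (hpole : pole = true) {E : ℝ} (hE : 0 ≤ E)
    (hpack : ∀ t : ℝ, ∃ (S : Finset ℂ) (m : ℂ → ℕ) (ψ : ℂ → ℂ),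
      (∀ a ∈ S, F a = 0 ∧ 0 < m a ∧ ‖a - (1 + η / 32 + t * I)‖ ≤ η / 4) ∧
      (∀ a, F a = 0 → ‖a - (1 + η / 32 + t * I)‖ ≤ η / 4 → a ∈ S) ∧
      (∀ z ∈ ball (1 + η / 32 + t * I) (η / 4), F z ≠ 0 →
        ψ z = deriv F z / F z - ∑ a ∈ S, (m a : ℂ) / (z - a)) ∧
      (∀ z ∈ closedBall (1 + η / 32 + t * I) (η / 16),
        ‖ψ z‖ ≤ E * (Real.log Q + Real.log (|t| + 4))))
    {β γ : ℝ} (hzero : F (β + γ * I) = 0) (hγ : γ ≠ 0) (hβ1 : β < 1)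
    (hsmall : 1 - β ≤ 3 * η / 416) (hnearγ : |γ| < 6 * (1 - β)) :
    33 / (754 * (K₀ + E + 1) * (Real.log Q + Real.log (|(0 : ℝ)| + 4))) ≤ 1 - β := by
  have hη := h.eta_pos
  have hη1 := h.eta_le_one
  have hK₀ := h.K₀_nonneg
  have hQ := h.one_le_Q
  have hℒ1 : 1 ≤ Real.log Q + Real.log (|(0 : ℝ)| + 4) := TwistedZFR.one_le_ell hQ 0
  set u : ℝ := 1 - β with hu
  have hu0 : 0 < u := by rw [hu]; linarith
  set d : ℝ := 13 * u with hddef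
  have hdpos : 0 < d := by positivity
  have hd1 : d ≤ 3 * η / 32 := by rw [hddef]; linarith
  have hd1' : d ≤ 1 := by linarith
  -- the zero lies in the disc at height `0`
  have hnear : ‖(β + γ * I : ℂ) - (1 + η / 32)‖ ≤ η / 4 := by
    have h1 := Complex.norm_le_abs_re_add_abs_im ((β + γ * I : ℂ) - (1 + η / 32))
    have hre : ((β + γ * I : ℂ) - (1 + η / 32)).re = β - (1 + η / 32) := by simp
    have him : ((β + γ * I : ℂ) - (1 + η / 32)).im = γ := by simp
    rw [hre, him] at h1
    have h2 : |β - (1 + η / 32)| ≤ η / 32 + u := by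
      rw [abs_le]; constructor <;> linarith
    have h3 : |γ| ≤ 6 * u := hnearγ.le
    linarith
  -- the two inequalities
  have hA := h.re_LSeries₀_le_of_pos hdpos hd1'
  have hP := h.re_LSeries₁_real_le_of_pair hpole hpack hzero hγ hnear hdpos hd1
  have h114 := TwistedZFR.re_add_re_nonneg h.norm_le₁ h.summable (σ := 1 + d) (by linarith)
  set ℒ₀ : ℝ := Real.log Q + Real.log (|(0 : ℝ)| + 4) with hℒ₀
  have hℒ0 : 0 < ℒ₀ := by linarith
  -- the pair term `2(1+d−β)/((1+d−β)²+γ²) ≥ 7/(58u)`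
  have hγ2 : γ ^ 2 ≤ 36 * u ^ 2 := by
    have h6u : 0 ≤ 6 * u := by positivity
    have := mul_le_mul hnearγ.le hnearγ.le (abs_nonneg γ) h6u
    rw [← pow_two, ← pow_two, sq_abs] at this
    nlinarith
  have h14 : 1 + d - β = 14 * u := by rw [hddef, hu]; ring
  rw [h14] at hP
  have hpair : 7 / (58 * u) ≤ 2 * ((14 * u) / ((14 * u) ^ 2 + γ ^ 2)) := by
    rw [mul_div_assoc', div_le_div_iff₀ (by positivity) (by positivity)]
    nlinarith
  have h1d : 1 / d = 1 / (13 * u) := by rw [hddef]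
  rw [h1d] at hA
  have hkey : (33 / 754) / u ≤ K₀ + E * ℒ₀ := by
    have e : (33 / 754) / u = -(1 / (13 * u) - 7 / (58 * u)) := by
      field_simp; norm_num
    rw [e]
    linear_combination h114 + hA + hP + hpair
  set E₃ : ℝ := K₀ + E + 1 with hE₃
  have hE₃0 : 0 < E₃ := by rw [hE₃]; positivity
  have hkey2 : (33 / 754) / u ≤ E₃ * ℒ₀ := by
    have : K₀ + E * ℒ₀ ≤ E₃ * ℒ₀ := by rw [hE₃]; nlinarith
    linarith
  rw [div_le_iff₀ (by positivity)]
  rw [div_le_iff₀ hu0] at hkey2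
  nlinarith

end Cases

/-! ## MV Theorem 11.3, abstract form -/

section ZeroFree

variable (h : TwistedZFRData η A Cg c₁ K₀ C₂ pole Q Λ₀ Λ₁ Λ₂ F)
include h

/-- **The zero-free region (Montgomery–Vaughan Theorem 11.3, abstract twisted form).** Let
`E = E(η, A, C_g, c₁)` be the package constant, `E₁ = 3K₀ + 4E + 2C₂ + 6/η`,
`E₂ = 3K₀ + 4E + 2C₂ + 1`, `E₃ = K₀ + E + 1`. If
`0 < c ≤ min(1/(14E₁), 4/(105E₂), 33/(754E₃), 3η/416)` — a bound depending only on
`η, A, C_g, c₁, K₀, C₂` — then every zero `ρ = β + iγ` of `F` with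
`β > 1 − c/(log Q + log(|γ| + 4))` is real, and exists only if `pole = true`. Proof: Case 1 if
`pole = false`; if `pole = true` and `γ ≠ 0`: `β = 1` is excluded by `not_zero_of_re_eq_one`,
and `β < 1` by Cases 2 (`|γ| ≥ 6(1−β)`) and 3 (`|γ| < 6(1−β)`). [cite: MontgomeryVaughan2007, Theorem 11.3] -/
theorem zeroFree_of_le {c : ℝ} (hc : 0 < c)
    (hc1 : c ≤ 1 / (14 * (3 * K₀ + 4 * E[η, A, Cg, c₁] + 2 * C₂ + 6 / η)))
    (hc2 : c ≤ 4 / (105 * (3 * K₀ + 4 * E[η, A, Cg, c₁] + 2 * C₂ + 1)))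
    (hc3 : c ≤ 33 / (754 * (K₀ + E[η, A, Cg, c₁] + 1)))
    (hc4 : c ≤ 3 * η / 416)
    {ρ : ℂ} (hzero : F ρ = 0)
    (hregion : 1 - c / (Real.log Q + Real.log (|ρ.im| + 4)) < ρ.re) :
    pole = true ∧ ρ.im = 0 := by
  have hη := h.eta_pos
  have hK₀ := h.K₀_nonneg
  have hC₂ := h.C₂_nonneg
  have hQ := h.one_le_Q
  obtain ⟨E, hEdef⟩ : ∃ E : ℝ, E = E[η, A, Cg, c₁] := ⟨_, rfl⟩
  have hE : 0 ≤ E := by rw [hEdef]; exact h.packageConst_nonneg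
  rw [← hEdef] at hc1 hc2 hc3
  have hpack := h.exists_package
  rw [← hEdef] at hpack
  set E₁ : ℝ := 3 * K₀ + 4 * E + 2 * C₂ + 6 / η with hE₁
  set E₂ : ℝ := 3 * K₀ + 4 * E + 2 * C₂ + 1 with hE₂
  set E₃ : ℝ := K₀ + E + 1 with hE₃
  have h6pos : 0 < 6 / η := by positivity
  have hE₁0 : 0 < E₁ := by rw [hE₁]; positivity
  have hE₂0 : 0 < E₂ := by rw [hE₂]; positivity
  have hE₃0 : 0 < E₃ := by rw [hE₃]; positivity
  set β : ℝ := ρ.re with hβdef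
  set γ : ℝ := ρ.im with hγdef
  have hρ : ρ = β + γ * I := (Complex.re_add_im ρ).symm.trans (by simp [hβdef, hγdef, mul_comm])
  have hzero' : F (β + γ * I) = 0 := by rw [← hρ]; exact hzero
  set ℒ : ℝ := Real.log Q + Real.log (|γ| + 4) with hℒ
  have hℒ1 : 1 ≤ ℒ := TwistedZFR.one_le_ell hQ γ
  have hℒ0 : 0 < ℒ := by linarith
  have hβ1 : β ≤ 1 := h.re_le_one_of_zero hzero
  have hgap : 1 - β < c / ℒ := by linarith
  have hcℒ : c / ℒ ≤ c := div_le_self hc.le hℒ1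
  have hsmall : 1 - β < 3 * η / 416 := by linarith
  have hβ' : 1 - 7 * η / 32 ≤ β := by linarith
  have hdiv : ∀ K' : ℝ, c ≤ K' → c / ℒ ≤ K' / ℒ := fun K' hK' ↦
    div_le_div_of_nonneg_right hK' hℒ0.le
  cases hp : pole with
  | false =>
    -- Case 1
    exfalso
    subst hp
    have h1 := h.one_sub_re_ge_of_noPole rfl hE hpack hzero' hβ'
    have h' : 1 / (14 * E₁ * ℒ) = (1 / (14 * E₁)) / ℒ := by rw [div_div]
    rw [h'] at h1
    linarith [hdiv _ hc1]
  | true =>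
    refine ⟨rfl, ?_⟩
    subst hp
    by_contra hγ0
    rcases eq_or_lt_of_le hβ1 with hβe | hβlt
    · exact h.not_zero_of_re_eq_one hE hpack hzero' hβe hγ0
    rcases le_or_gt (6 * (1 - β)) |γ| with hfar | hnear
    · -- Case 2
      have h2 := h.one_sub_re_ge_of_pole_far hE hpack hzero' hβlt (by linarith) hfar
      have h' : 4 / (105 * E₂ * ℒ) = (4 / (105 * E₂)) / ℒ := by rw [div_div]
      rw [h'] at h2
      linarith [hdiv _ hc2]
    · -- Case 3
      have h3 := h.one_sub_re_ge_of_pole_near rfl hE hpack hzero' hγ0 hβlt hsmall.le hnear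
      set ℒ₀ : ℝ := Real.log Q + Real.log (|(0 : ℝ)| + 4) with hℒ₀
      have hℒ₀1 : 1 ≤ ℒ₀ := TwistedZFR.one_le_ell hQ 0
      have hℒ₀ℒ : ℒ₀ ≤ ℒ := TwistedZFR.ell_zero_le Q γ
      have h' : 33 / (754 * E₃ * ℒ₀) = (33 / (754 * E₃)) / ℒ₀ := by rw [div_div]
      rw [h'] at h3
      have h4 : (33 / (754 * E₃)) / ℒ ≤ (33 / (754 * E₃)) / ℒ₀ :=
        div_le_div_of_nonneg_left (by positivity) (by linarith) hℒ₀ℒ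
      linarith [hdiv _ hc3]

end ZeroFree

/-- **The zero-free region with the constant quantified before the data**: for all numeric
parameters `η > 0`, `A ≥ 0`, `C_g`, `c₁`, `K₀ ≥ 0`, `C₂ ≥ 0` there is `c > 0` such that for EVERY
datum `TwistedZFRData η A C_g c₁ K₀ C₂ pole Q Λ₀ Λ₁ Λ₂ F` (any conductor `Q`, any twist), every zero
`ρ` of `F` with `Re ρ > 1 − c/(log Q + log(|Im ρ| + 4))` is real and `pole = true`. This is the
uniformity in `q` and in the character of MV Theorem 11.3 / Mitsui's Lemma 5.
[cite: MontgomeryVaughan2007, Theorem 11.3] -/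
theorem exists_zeroFree_const {η A Cg c₁ K₀ C₂ : ℝ} (hη : 0 < η) (hA : 0 ≤ A) (hK₀ : 0 ≤ K₀)
    (hC₂ : 0 ≤ C₂) :
    ∃ c : ℝ, 0 < c ∧ ∀ (pole : Bool) (Q : ℝ) (Λ₀ : ℕ → ℝ) (Λ₁ Λ₂ : ℕ → ℂ) (F : ℂ → ℂ),
      TwistedZFRData η A Cg c₁ K₀ C₂ pole Q Λ₀ Λ₁ Λ₂ F → ∀ ρ : ℂ, F ρ = 0 →
        1 - c / (Real.log Q + Real.log (|ρ.im| + 4)) < ρ.re → pole = true ∧ ρ.im = 0 := by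
  obtain ⟨E, hEdef⟩ : ∃ E : ℝ, E = E[η, A, Cg, c₁] := ⟨_, rfl⟩
  have hE : 0 ≤ E := by rw [hEdef]; positivity
  set E₁ : ℝ := 3 * K₀ + 4 * E + 2 * C₂ + 6 / η with hE₁
  set E₂ : ℝ := 3 * K₀ + 4 * E + 2 * C₂ + 1 with hE₂
  set E₃ : ℝ := K₀ + E + 1 with hE₃
  have h6pos : 0 < 6 / η := by positivity
  have hE₁0 : 0 < E₁ := by rw [hE₁]; positivity
  have hE₂0 : 0 < E₂ := by rw [hE₂]; positivity
  have hE₃0 : 0 < E₃ := by rw [hE₃]; positivity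
  set c : ℝ := min (min (1 / (14 * E₁)) (4 / (105 * E₂))) (min (33 / (754 * E₃)) (3 * η / 416))
    with hcdef
  have hc1 : c ≤ 1 / (14 * E₁) := (min_le_left _ _).trans (min_le_left _ _)
  have hc2 : c ≤ 4 / (105 * E₂) := (min_le_left _ _).trans (min_le_right _ _)
  have hc3 : c ≤ 33 / (754 * E₃) := (min_le_right _ _).trans (min_le_left _ _)
  have hc4 : c ≤ 3 * η / 416 := (min_le_right _ _).trans (min_le_right _ _)
  have hcpos : 0 < c := lt_min (lt_min (by positivity) (by positivity))
    (lt_min (by positivity) (by positivity))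
  refine ⟨c, hcpos, fun pole Q Λ₀ Λ₁ Λ₂ F h ρ hzero hregion ↦ ?_⟩
  rw [hE₁, hEdef] at hc1
  rw [hE₂, hEdef] at hc2
  rw [hE₃, hEdef] at hc3
  exact h.zeroFree_of_le hcpos hc1 hc2 hc3 hc4 hzero hregion

/-! ## `F'/F` near `σ = 1`, away from the exceptional zeros (MV Theorem 11.4, crude form) -/

section LogDerivBound

variable (h : TwistedZFRData η A Cg c₁ K₀ C₂ pole Q Λ₀ Λ₁ Λ₂ F)
include h

/-- The crude bound to the right of `σ = 1`: `‖F'/F(s)‖ ≤ 1/(min(σ,2) − 1) + K₀` for `σ > 1`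
(`|L(Λ₁, s)| ≤ Re L(Λ₀, min(σ,2))`). [cite: MontgomeryVaughan2007, Theorem 11.4 (proof, p. 277)] -/
theorem norm_logDeriv_le_of_one_lt_re (s : ℂ) (hs : 1 < s.re) :
    ‖deriv F s / F s‖ ≤ 1 / (min s.re 2 - 1) + K₀ := by
  set σ' : ℝ := min s.re 2 with hσ'
  have hσ'1 : 1 < σ' := lt_min hs (by norm_num)
  have hσ'2 : σ' ≤ 2 := min_le_right _ _
  have hσ's : σ' ≤ s.re := min_le_left _ _
  rw [h.logDeriv_eq s hs, norm_neg]
  exact (TwistedZFR.norm_LSeries_le_of_norm_le h.norm_le₁ h.summable hσ'1 hσ's).trans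
    (h.re_LSeries₀_le σ' hσ'1 hσ'2)

/-- **Total multiplicity of the zeros in the Lemma-α disc** (MV (11.11)): with the package at
height `t` and `s₁ = 1 + κ + it`, `κ = η/(16ℒ)`, `ℒ = log Q + log(|t| + 4)`:
`∑_{a ∈ S} m(a) ≤ (16/η)(16/η + K₀ + E) ℒ²`, because `Re ∑ m(a)/(s₁ − a) ≤ ‖F'/F(s₁)‖ + ‖ψ(s₁)‖ ≤
(16/η + K₀ + E)ℒ` and `Re 1/(s₁ − a) ≥ Re (s₁ − a) ≥ κ` for `|s₁ − a| ≤ 1`.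
[cite: MontgomeryVaughan2007, Theorem 11.4 (proof, eq. (11.11))] -/
theorem sum_mult_le {E : ℝ} (hE : 0 ≤ E) {t : ℝ} {S : Finset ℂ} {m : ℂ → ℕ} {ψ : ℂ → ℂ}
    (hS : ∀ a ∈ S, F a = 0 ∧ 0 < m a ∧ ‖a - (1 + η / 32 + t * I)‖ ≤ η / 4)
    (hψ : ∀ z ∈ ball (1 + η / 32 + t * I) (η / 4), F z ≠ 0 →
          ψ z = deriv F z / F z - ∑ a ∈ S, (m a : ℂ) / (z - a))
    (hψb : ∀ z ∈ closedBall (1 + η / 32 + t * I) (η / 16),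
          ‖ψ z‖ ≤ E * (Real.log Q + Real.log (|t| + 4))) :
    (∑ a ∈ S, (m a : ℝ)) ≤
      16 / η * (16 / η + K₀ + E) * (Real.log Q + Real.log (|t| + 4)) ^ 2 := by
  have hη := h.eta_pos
  have hη1 := h.eta_le_one
  have hK₀ := h.K₀_nonneg
  have hQ := h.one_le_Q
  set ℒ : ℝ := Real.log Q + Real.log (|t| + 4) with hℒ
  have hℒ1 : 1 ≤ ℒ := TwistedZFR.one_le_ell hQ t
  have hℒ0 : 0 < ℒ := by linarith
  set κ : ℝ := η / (16 * ℒ) with hκdef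
  have hκ : 0 < κ := by positivity
  have hκ1 : κ ≤ η / 16 := by
    rw [hκdef]; exact div_le_div_of_nonneg_left hη.le (by norm_num) (by nlinarith)
  obtain ⟨s₁, hs₁⟩ : ∃ s₁ : ℂ, s₁ = ((1 + κ : ℝ) : ℂ) + t * I := ⟨_, rfl⟩
  have hs₁re : s₁.re = 1 + κ := by simp [hs₁]
  have hs₁1 : 1 < s₁.re := by rw [hs₁re]; linarith
  set c : ℂ := 1 + η / 32 + t * I with hcdef
  have hs₁c : ‖s₁ - c‖ ≤ η / 16 := by
    have : s₁ - c = ((κ - η / 32 : ℝ) : ℂ) := by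
      simp only [hs₁, hcdef]; push_cast; ring
    rw [this, Complex.norm_real, Real.norm_eq_abs, abs_le]
    constructor <;> linarith
  have hs₁ball : s₁ ∈ ball c (η / 4) := mem_ball_iff_norm.2 (by linarith)
  have hs₁cl : s₁ ∈ closedBall c (η / 16) := mem_closedBall_iff_norm.2 hs₁c
  have hF₁ : F s₁ ≠ 0 := h.ne_zero s₁ hs₁1
  have hψ₁ := hψ s₁ hs₁ball hF₁
  -- `Re ∑ ≤ (16/η + K₀ + E) ℒ`
  have hbound : (∑ a ∈ S, (m a : ℂ) / (s₁ - a)).re ≤ (16 / η + K₀ + E) * ℒ := by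
    have hEq : ∑ a ∈ S, (m a : ℂ) / (s₁ - a) = deriv F s₁ / F s₁ - ψ s₁ := by
      rw [hψ₁]; ring
    rw [hEq, Complex.sub_re]
    have h1 : ‖deriv F s₁ / F s₁‖ ≤ 16 / η * ℒ + K₀ := by
      have := h.norm_logDeriv_le_of_one_lt_re s₁ hs₁1
      have hmin : min s₁.re 2 = 1 + κ := by rw [hs₁re]; exact min_eq_left (by linarith)
      rw [hmin, show 1 + κ - 1 = κ by ring, hκdef, one_div_div] at this
      convert this using 2; ring
    have h2 := hψb s₁ hs₁cl
    have h3 := Complex.abs_re_le_norm (deriv F s₁ / F s₁)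
    have h4 := Complex.abs_re_le_norm (ψ s₁)
    have hK₀ℒ : K₀ ≤ K₀ * ℒ := by nlinarith
    rw [abs_le] at h3 h4
    nlinarith [h3.2, h4.1]
  -- each term: `m(a) κ ≤ Re (m(a)/(s₁ − a))`
  have hterm : ∀ a ∈ S, (m a : ℝ) * κ ≤ ((m a : ℂ) / (s₁ - a)).re := by
    intro a ha
    obtain ⟨hFa, -, hac⟩ := hS a ha
    have hare : a.re ≤ 1 := h.re_le_one_of_zero hFa
    have hn : ‖s₁ - a‖ ≤ 1 := by
      calc ‖s₁ - a‖ = ‖(s₁ - c) + (c - a)‖ := by ring_nf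
        _ ≤ ‖s₁ - c‖ + ‖c - a‖ := norm_add_le _ _
        _ ≤ η / 16 + η / 4 := by rw [norm_sub_rev c a]; exact add_le_add hs₁c hac
        _ ≤ 1 := by linarith
    have hre0 : κ ≤ (s₁ - a).re := by
      simp only [Complex.sub_re, hs₁re]; linarith
    have hinv := DirichletZFR.re_le_re_inv hn (by linarith)
    have hre : ((m a : ℂ) / (s₁ - a)).re = (m a : ℝ) * ((s₁ - a)⁻¹).re := by
      rw [div_eq_mul_inv, show ((m a : ℕ) : ℂ) = ((m a : ℝ) : ℂ) by simp, Complex.re_ofReal_mul]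
    rw [hre]
    exact mul_le_mul_of_nonneg_left (hre0.trans hinv) (Nat.cast_nonneg _)
  have hsum : (∑ a ∈ S, (m a : ℝ)) * κ ≤ (16 / η + K₀ + E) * ℒ := by
    rw [Finset.sum_mul]
    refine le_trans ?_ hbound
    rw [Complex.re_sum]
    exact Finset.sum_le_sum hterm
  rw [hκdef, ← le_div_iff₀ (by positivity)] at hsum
  refine hsum.trans (le_of_eq ?_)
  field_simp

end LogDerivBound

set_option maxHeartbeats 1600000 in
/-- **`F'/F(s) ≪ (log Q + log 4)³/d · log(|t|+4)` near `σ = 1`, away from the exceptional zeros**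
(crude form of MV Theorem 11.4, (11.5)/(11.8), abstract twisted version): for all numeric
parameters there are `c > 0`, `C ≥ 0` such that for EVERY datum `TwistedZFRData … pole Q Λ₀ Λ₁ Λ₂ F`,
every `s = σ + it` with `σ ≥ 1 − c/(log Q + log(|t| + 4))` and every `0 < d ≤ 1` with `|s − a| ≥ d`
for all real zeros `a` of `F` with `a > 1 − 2c/(log Q + log 4)` (there are none unless
`pole = true`, first clause), `F(s) ≠ 0` and `‖F'/F(s)‖ ≤ C ((log Q + log 4)³ / d) · log(|t| + 4)`.
Proof as in `DirichletZFR.exists_norm_logDeriv_le_of_re_ge` (MV p. 278) with the radii `η/4`,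
`η/16` and `s₁ = 1 + η/(16ℒ) + it`. [cite: MontgomeryVaughan2007, Theorem 11.4] -/
theorem exists_logDeriv_bound_const {η A Cg c₁ K₀ C₂ : ℝ} (hη : 0 < η) (hη1 : η ≤ 1) (hA : 0 ≤ A)
    (hK₀ : 0 ≤ K₀) (hC₂ : 0 ≤ C₂) :
    ∃ c : ℝ, 0 < c ∧ ∃ C : ℝ, 0 ≤ C ∧
      (∀ (pole : Bool) (Q : ℝ) (Λ₀ : ℕ → ℝ) (Λ₁ Λ₂ : ℕ → ℂ) (F : ℂ → ℂ),
        TwistedZFRData η A Cg c₁ K₀ C₂ pole Q Λ₀ Λ₁ Λ₂ F → ∀ ρ : ℂ, F ρ = 0 →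
          1 - 2 * c / (Real.log Q + Real.log (|ρ.im| + 4)) < ρ.re → pole = true ∧ ρ.im = 0) ∧
      ∀ (pole : Bool) (Q : ℝ) (Λ₀ : ℕ → ℝ) (Λ₁ Λ₂ : ℕ → ℂ) (F : ℂ → ℂ),
        TwistedZFRData η A Cg c₁ K₀ C₂ pole Q Λ₀ Λ₁ Λ₂ F →
        ∀ (s : ℂ) (d : ℝ), 0 < d → d ≤ 1 →
          1 - c / (Real.log Q + Real.log (|s.im| + 4)) ≤ s.re →
          (∀ a : ℂ, F a = 0 → a.im = 0 →
            1 - 2 * c / (Real.log Q + Real.log 4) < a.re → d ≤ ‖s - a‖) →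
          F s ≠ 0 ∧
            ‖deriv F s / F s‖ ≤
              C * ((Real.log Q + Real.log 4) ^ 3 / d) * Real.log (|s.im| + 4) := by
  obtain ⟨c₀, hc₀, hzf⟩ := exists_zeroFree_const (Cg := Cg) (c₁ := c₁) hη hA hK₀ hC₂
  obtain ⟨E, hEdef⟩ : ∃ E : ℝ, E = E[η, A, Cg, c₁] := ⟨_, rfl⟩
  have hE : 0 ≤ E := by rw [hEdef]; positivity
  -- constants
  set c : ℝ := min (c₀ / 4) (η / 32) with hcdef
  have hc4 : c ≤ c₀ / 4 := min_le_left _ _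
  have hcη : c ≤ η / 32 := min_le_right _ _
  have hcpos : 0 < c := lt_min (by positivity) (by positivity)
  clear_value c
  have hzf2 : ∀ (pole : Bool) (Q : ℝ) (Λ₀ : ℕ → ℝ) (Λ₁ Λ₂ : ℕ → ℂ) (F : ℂ → ℂ),
      TwistedZFRData η A Cg c₁ K₀ C₂ pole Q Λ₀ Λ₁ Λ₂ F → ∀ ρ : ℂ, F ρ = 0 →
      1 - 2 * c / (Real.log Q + Real.log (|ρ.im| + 4)) < ρ.re → pole = true ∧ ρ.im = 0 := by
    intro pole Q Λ₀ Λ₁ Λ₂ F h ρ hρ hre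
    refine hzf pole Q Λ₀ Λ₁ Λ₂ F h ρ hρ (lt_of_le_of_lt ?_ hre)
    have hℒ := TwistedZFR.ell_pos h.one_le_Q ρ.im
    have : 2 * c / (Real.log Q + Real.log (|ρ.im| + 4)) ≤
        c₀ / (Real.log Q + Real.log (|ρ.im| + 4)) :=
      div_le_div_of_nonneg_right (by linarith) hℒ.le
    linarith
  set U : ℝ := 16 / η + K₀ + E with hU
  have hU0 : 0 ≤ U := by rw [hU]; positivity
  set Kc : ℝ := 2 * (η / (16 * c) + 2) with hKc
  have hKc0 : 0 ≤ Kc := by rw [hKc]; positivity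
  clear_value Kc
  have hKcU : 0 ≤ Kc * U := mul_nonneg hKc0 hU0
  have h20 : 0 ≤ 1 + 20 / η := by positivity
  set C : ℝ := (E + U + Kc * U + 16 / η + K₀) + 25 / η * U * (1 + 20 / η) + 1 with hCdef
  have hCpos : 0 ≤ C := by rw [hCdef]; positivity
  clear_value C
  refine ⟨c, hcpos, C, hCpos, hzf2, fun pole Q Λ₀ Λ₁ Λ₂ F h s d hd hd1 hregion hexc ↦ ?_⟩
  have hQ := h.one_le_Q
  have hpack := h.exists_package
  rw [← hEdef] at hpack
  obtain ⟨σ, hσdef⟩ : ∃ σ : ℝ, s.re = σ := ⟨_, rfl⟩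
  obtain ⟨t, htdef⟩ : ∃ t : ℝ, s.im = t := ⟨_, rfl⟩
  have hs : s = σ + t * I := by
    rw [← hσdef, ← htdef]; exact (Complex.re_add_im s).symm.trans (by simp [mul_comm])
  rw [hσdef, htdef] at hregion
  rw [htdef]
  have hlogQ : 0 ≤ Real.log Q := Real.log_nonneg hQ
  have hlog4 : 1 ≤ Real.log 4 := by
    have := ClassicalZFRData.one_le_log_tau 0
    rwa [abs_zero, zero_add] at this
  have hlogτ : 1 ≤ Real.log (|t| + 4) := ClassicalZFRData.one_le_log_tau t
  have hlog4τ : Real.log 4 ≤ Real.log (|t| + 4) :=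
    Real.log_le_log (by norm_num) (by linarith [abs_nonneg t])
  have hell5 : |t| ≤ 1 → Real.log Q + Real.log (|t| + 4) ≤
      5 / 4 * (Real.log Q + Real.log 4) := fun ht ↦ by
    have := TwistedZFR.ell_le_of_abs_le hQ (t := 0) (t' := t) (by rw [abs_zero]; linarith)
    rwa [abs_zero, zero_add] at this
  set ℒ : ℝ := Real.log Q + Real.log (|t| + 4) with hℒ
  set ℒ₀ : ℝ := Real.log Q + Real.log 4 with hℒ₀
  have hℒ1 : 1 ≤ ℒ := TwistedZFR.one_le_ell hQ t
  have hℒ0 : 0 < ℒ := by linarith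
  have hℒ₀1 : 1 ≤ ℒ₀ := by rw [hℒ₀]; linarith
  have hℒ₀0 : 0 < ℒ₀ := by linarith
  have hℒ₀ℒ : ℒ₀ ≤ ℒ := by rw [hℒ₀, hℒ]; linarith
  have hℒprod : ℒ ≤ ℒ₀ * Real.log (|t| + 4) := by
    rw [hℒ, hℒ₀, add_mul]; nlinarith
  clear_value ℒ ℒ₀
  have hcℒ : c / ℒ ≤ c := div_le_self hcpos.le hℒ1
  -- every zero `a` with `Re a > 1 − 2c/ℒ` and `|Im a| ≤ |t| + 1` is real and far from `s`
  have hreal : ∀ a : ℂ, F a = 0 → |a.im| ≤ |t| + 1 → 1 - 2 * c / ℒ < a.re →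
      a.im = 0 ∧ d ≤ ‖s - a‖ := by
    intro a hFa haim hare
    have hℒa := TwistedZFR.ell_le_of_abs_le hQ haim
    rw [← hℒ] at hℒa
    have hℒa0 : 0 < Real.log Q + Real.log (|a.im| + 4) := TwistedZFR.ell_pos hQ a.im
    have h1 : c₀ / ℒ * (4 / 5) ≤ c₀ / (Real.log Q + Real.log (|a.im| + 4)) := by
      rw [div_mul_eq_mul_div, div_le_div_iff₀ (by positivity) hℒa0]
      nlinarith
    have h2 : 2 * c / ℒ ≤ c₀ / ℒ * (4 / 5) := by
      rw [div_mul_eq_mul_div, div_le_div_iff₀ hℒ0 (by positivity)]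
      have : 2 * c ≤ c₀ * 4 / 5 := by linarith
      nlinarith
    have hzone : 1 - c₀ / (Real.log Q + Real.log (|a.im| + 4)) < a.re := by linarith
    obtain ⟨-, him⟩ := hzf pole Q Λ₀ Λ₁ Λ₂ F h a hFa hzone
    have h3 : 2 * c / ℒ ≤ 2 * c / ℒ₀ :=
      div_le_div_of_nonneg_left (by positivity) hℒ₀0 hℒ₀ℒ
    exact ⟨him, hexc a hFa him (by linarith)⟩
  -- `F(s) ≠ 0`
  have hFs : F s ≠ 0 := by
    intro hFs
    have him : |s.im| ≤ |t| + 1 := by rw [htdef]; linarith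
    have hre : 1 - 2 * c / ℒ < s.re := by
      have h1 : 0 < c / ℒ := by positivity
      have h2 : 2 * c / ℒ = 2 * (c / ℒ) := by ring
      rw [hσdef]; linarith
    obtain ⟨-, hds⟩ := hreal _ hFs him hre
    rw [sub_self, norm_zero] at hds
    linarith
  refine ⟨hFs, ?_⟩
  have hℒ₀3 : ℒ₀ ≤ ℒ₀ ^ 3 / d := by
    rw [le_div_iff₀ hd]
    calc ℒ₀ * d ≤ ℒ₀ * 1 := mul_le_mul_of_nonneg_left hd1 hℒ₀0.le
      _ ≤ ℒ₀ ^ 3 := by nlinarith [one_le_pow₀ (n := 2) hℒ₀1]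
  have hℒ₀3d : 0 ≤ ℒ₀ ^ 3 / d := div_nonneg (pow_nonneg hℒ₀0.le 3) hd.le
  -- a bound `B ℒ ≤ B ℒ₀³/d · log(|t|+4)` for non-negative `B`
  have hscale : ∀ B : ℝ, 0 ≤ B → B * ℒ ≤ B * (ℒ₀ ^ 3 / d) * Real.log (|t| + 4) := by
    intro B hB
    calc B * ℒ ≤ B * (ℒ₀ * Real.log (|t| + 4)) := mul_le_mul_of_nonneg_left hℒprod hB
      _ ≤ B * (ℒ₀ ^ 3 / d * Real.log (|t| + 4)) :=
          mul_le_mul_of_nonneg_left (mul_le_mul_of_nonneg_right hℒ₀3 (by linarith only [hlogτ])) hB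
      _ = B * (ℒ₀ ^ 3 / d) * Real.log (|t| + 4) := by ring
  have hK₀ℒ : K₀ ≤ K₀ * ℒ := by nlinarith
  -- `κ = η/(16ℒ)`, `σ₁ = 1 + κ`
  set κ : ℝ := η / (16 * ℒ) with hκdef
  have hκ : 0 < κ := by positivity
  have hκ1 : κ ≤ η / 16 := by
    rw [hκdef]; exact div_le_div_of_nonneg_left hη.le (by norm_num) (by nlinarith)
  have hκinv : 1 / κ = 16 / η * ℒ := by rw [hκdef, one_div_div]; ring
  set σ₁ : ℝ := 1 + κ with hσ₁
  have hσ₁1 : 1 < σ₁ := by rw [hσ₁]; linarith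
  rcases le_or_gt σ₁ σ with hbig | hsmallσ
  · -- the easy case `σ ≥ σ₁`: `‖F'/F‖ ≤ 16ℒ/η + K₀`
    have h3 : 1 / (min σ 2 - 1) ≤ 16 / η * ℒ := by
      have hmin : κ ≤ min σ 2 - 1 := by
        rw [le_sub_iff_add_le]
        exact le_min (by rw [hσ₁] at hbig; linarith) (by linarith)
      calc 1 / (min σ 2 - 1) ≤ 1 / κ := one_div_le_one_div_of_le hκ hmin
        _ = 16 / η * ℒ := hκinv
    have hbound : 1 / (min σ 2 - 1) + K₀ ≤ C * (ℒ₀ ^ 3 / d) * Real.log (|t| + 4) := by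
      have h4 : 1 / (min σ 2 - 1) + K₀ ≤ (16 / η + K₀) * ℒ := by linarith
      have h5 := hscale (16 / η + K₀) (by positivity)
      have h6 : (16 / η + K₀) * (ℒ₀ ^ 3 / d) * Real.log (|t| + 4) ≤
          C * (ℒ₀ ^ 3 / d) * Real.log (|t| + 4) := by
        refine mul_le_mul_of_nonneg_right (mul_le_mul_of_nonneg_right ?_ hℒ₀3d) (by linarith)
        rw [hCdef]
        have : 0 ≤ 25 / η * U * (1 + 20 / η) := by positivity
        linarith
      linarith
    have h1 : 1 < s.re := by rw [hσdef]; linarith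
    have h2 := h.norm_logDeriv_le_of_one_lt_re s h1
    rw [hσdef] at h2
    exact h2.trans hbound
  -- pure real-variable facts for the main case
  have hKc_ge : (κ + c / ℒ) / κ * ((κ + c / ℒ) / (c / ℒ) + 1) ≤ Kc := by
    have e1 : (κ + c / ℒ) / κ = 1 + 16 * c / η := by rw [hκdef]; field_simp
    have e2 : (κ + c / ℒ) / (c / ℒ) = η / (16 * c) + 1 := by rw [hκdef]; field_simp
    rw [e1, e2]
    have h1 : 1 + 16 * c / η ≤ 2 := by
      have : 16 * c / η ≤ 1 / 2 := by
        rw [div_le_div_iff₀ hη (by norm_num)]; linarith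
      linarith
    have h0 : 0 ≤ η / (16 * c) + 1 + 1 := by positivity
    calc (1 + 16 * c / η) * (η / (16 * c) + 1 + 1) ≤ 2 * (η / (16 * c) + 1 + 1) :=
          mul_le_mul_of_nonneg_right h1 h0
      _ = Kc := by rw [hKc]; ring
  have h2c : 2 * c / ℒ = 2 * (c / ℒ) := by ring
  have hposA : 0 ≤ E + U + Kc * U := by linarith only [hE, hU0, hKcU]
  have hposd : 0 < 1 / d := by positivity
  have h25 : 0 ≤ 25 / η * U := by positivity
  have hX0 : 0 ≤ 25 / η * U * ℒ₀ ^ 2 * (1 / d + 20 / η * ℒ₀) := by positivity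
  have hB : 25 / η * U * ℒ₀ ^ 2 * (1 / d + 20 / η * ℒ₀) ≤
      (25 / η * U * (1 + 20 / η)) * (ℒ₀ ^ 3 / d) * Real.log (|t| + 4) := by
    have hd' : 1 ≤ 1 / d := by
      rw [le_div_iff₀ hd]; linarith only [hd1]
    have hℒ₀cube : ℒ₀ ^ 2 ≤ ℒ₀ ^ 3 := pow_le_pow_right₀ hℒ₀1 (by norm_num)
    have hℒ₀3nn : 0 ≤ ℒ₀ ^ 3 := pow_nonneg hℒ₀0.le 3
    have h2 : ℒ₀ ^ 2 * (1 / d) ≤ ℒ₀ ^ 3 * (1 / d) := mul_le_mul_of_nonneg_right hℒ₀cube hposd.le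
    have h3 : ℒ₀ ^ 3 * 1 ≤ ℒ₀ ^ 3 * (1 / d) := mul_le_mul_of_nonneg_left hd' hℒ₀3nn
    have h20η : 0 ≤ 20 / η := by positivity
    have h1 : ℒ₀ ^ 2 * (1 / d + 20 / η * ℒ₀) ≤ (1 + 20 / η) * (ℒ₀ ^ 3 / d) := by
      have e1 : ℒ₀ ^ 2 * (1 / d + 20 / η * ℒ₀) = ℒ₀ ^ 2 * (1 / d) + 20 / η * (ℒ₀ ^ 3 * 1) := by ring
      have e2 : (1 + 20 / η) * (ℒ₀ ^ 3 / d) = ℒ₀ ^ 3 * (1 / d) + 20 / η * (ℒ₀ ^ 3 * (1 / d)) := by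
        ring
      rw [e1, e2]
      have := mul_le_mul_of_nonneg_left h3 h20η
      linarith only [h2, this]
    have h13U' : 0 ≤ (25 / η * U * (1 + 20 / η)) * (ℒ₀ ^ 3 / d) := by positivity
    have e3 : 25 / η * U * ℒ₀ ^ 2 * (1 / d + 20 / η * ℒ₀) =
        25 / η * U * (ℒ₀ ^ 2 * (1 / d + 20 / η * ℒ₀)) := by ring
    have e4 : 25 / η * U * ((1 + 20 / η) * (ℒ₀ ^ 3 / d)) =
        (25 / η * U * (1 + 20 / η)) * (ℒ₀ ^ 3 / d) * 1 := by ring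
    have h5 : 25 / η * U * (ℒ₀ ^ 2 * (1 / d + 20 / η * ℒ₀)) ≤
        25 / η * U * ((1 + 20 / η) * (ℒ₀ ^ 3 / d)) := mul_le_mul_of_nonneg_left h1 h25
    have h6 : (25 / η * U * (1 + 20 / η)) * (ℒ₀ ^ 3 / d) * 1 ≤
        (25 / η * U * (1 + 20 / η)) * (ℒ₀ ^ 3 / d) * Real.log (|t| + 4) :=
      mul_le_mul_of_nonneg_left hlogτ h13U'
    rw [e3]
    rw [e4] at h5
    exact h5.trans h6
  have hA' := hscale (E + U + Kc * U) hposA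
  have hC : (E + U + Kc * U) * (ℒ₀ ^ 3 / d) * Real.log (|t| + 4) +
      (25 / η * U * (1 + 20 / η)) * (ℒ₀ ^ 3 / d) * Real.log (|t| + 4) ≤
        C * (ℒ₀ ^ 3 / d) * Real.log (|t| + 4) := by
    rw [← add_mul, ← add_mul]
    have hlogτ0 : 0 ≤ Real.log (|t| + 4) := by linarith only [hlogτ]
    refine mul_le_mul_of_nonneg_right (mul_le_mul_of_nonneg_right ?_ hℒ₀3d) hlogτ0
    rw [hCdef]
    have : 0 ≤ 16 / η := by positivity
    linarith only [hK₀, this]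
  have htarget : (E + U + Kc * U) * ℒ + 25 / η * U * ℒ₀ ^ 2 * (1 / d + 20 / η * ℒ₀) ≤
      C * (ℒ₀ ^ 3 / d) * Real.log (|t| + 4) := by linarith only [hA', hB, hC]
  have hnearScale : |t| ≤ 1 →
      (16 / η * U * ℒ ^ 2) * (1 / d + 16 / η * ℒ) ≤
        25 / η * U * ℒ₀ ^ 2 * (1 / d + 20 / η * ℒ₀) := by
    intro ht
    have hℒℒ₀ : ℒ ≤ 5 / 4 * ℒ₀ := hell5 ht
    have h16 : 0 ≤ 16 / η := by positivity
    calc (16 / η * U * ℒ ^ 2) * (1 / d + 16 / η * ℒ)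
        ≤ (16 / η * U * (5 / 4 * ℒ₀) ^ 2) * (1 / d + 16 / η * (5 / 4 * ℒ₀)) := by
          have h1 : ℒ ^ 2 ≤ (5 / 4 * ℒ₀) ^ 2 := pow_le_pow_left₀ hℒ0.le hℒℒ₀ 2
          have h2 : 1 / d + 16 / η * ℒ ≤ 1 / d + 16 / η * (5 / 4 * ℒ₀) := by
            have := mul_le_mul_of_nonneg_left hℒℒ₀ h16
            linarith only [this]
          have h3 : 0 ≤ 1 / d + 16 / η * ℒ := by positivity
          have h4 : 0 ≤ 16 / η * U := by positivity
          have h5 : 0 ≤ 16 / η * U * (5 / 4 * ℒ₀) ^ 2 := mul_nonneg h4 (sq_nonneg _)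
          exact mul_le_mul (mul_le_mul_of_nonneg_left h1 h4) h2 h3 h5
      _ = 25 / η * U * ℒ₀ ^ 2 * (1 / d + 20 / η * ℒ₀) := by ring
  -- the main case `1 − c/ℒ ≤ σ < σ₁`: `s` and `s₁` lie in the small disc at height `t`
  obtain ⟨S, m, ψ, hS, hS', hψ, hψb⟩ := hpack t
  have hmult := h.sum_mult_le hE hS hψ hψb
  rw [← hℒ] at hmult
  obtain ⟨cc, hccdef⟩ : ∃ cc : ℂ, cc = 1 + η / 32 + t * I := ⟨_, rfl⟩
  rw [← hccdef] at hS hS' hψ hψb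
  have hccim : cc.im = t := by rw [hccdef]; simp
  have hσlow : 1 - η / 32 ≤ σ := by
    have h1 : c / ℒ ≤ η / 32 := hcℒ.trans hcη
    linarith only [h1, hregion]
  have hsc : ‖s - cc‖ ≤ η / 16 := by
    have : s - cc = ((σ - (1 + η / 32) : ℝ) : ℂ) := by rw [hs, hccdef]; push_cast; ring
    rw [this, Complex.norm_real, Real.norm_eq_abs]
    refine abs_le.2 ⟨by linarith only [hσlow, hη], ?_⟩
    rw [hσ₁] at hsmallσ
    linarith only [hsmallσ, hκ1, hη]
  have hsball : s ∈ ball cc (η / 4) :=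
    mem_ball_iff_norm.2 (by linarith only [hsc, hη])
  have hscl : s ∈ closedBall cc (η / 16) := mem_closedBall_iff_norm.2 hsc
  have hψs := hψ _ hsball hFs
  -- the auxiliary point `s₁`
  obtain ⟨s₁, hs₁⟩ : ∃ s₁ : ℂ, s₁ = (σ₁ : ℂ) + t * I := ⟨_, rfl⟩
  have hs₁re : s₁.re = σ₁ := by simp [hs₁]
  have hs₁im : s₁.im = t := by simp [hs₁]
  have hs₁1 : 1 < s₁.re := by rw [hs₁re]; exact hσ₁1
  have hs₁c : ‖s₁ - cc‖ ≤ η / 16 := by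
    have : s₁ - cc = ((σ₁ - (1 + η / 32) : ℝ) : ℂ) := by
      simp only [hs₁, hccdef]; push_cast; ring
    rw [this, Complex.norm_real, Real.norm_eq_abs, hσ₁]
    exact abs_le.2 ⟨by linarith only [hκ, hη], by linarith only [hκ1, hη]⟩
  have hs₁ball : s₁ ∈ ball cc (η / 4) := mem_ball_iff_norm.2 (by linarith only [hs₁c, hη])
  have hs₁cl : s₁ ∈ closedBall cc (η / 16) := mem_closedBall_iff_norm.2 hs₁c
  have hF₁ : F s₁ ≠ 0 := h.ne_zero s₁ hs₁1
  have hψ₁ := hψ s₁ hs₁ball hF₁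
  -- light facts about the zeros in `S`
  have hSre : ∀ a ∈ S, a.re ≤ 1 := fun a ha ↦ h.re_le_one_of_zero (hS a ha).1
  have hSre₁ : ∀ a ∈ S, κ ≤ (s₁ - a).re := by
    intro a ha
    rw [Complex.sub_re, hs₁re, hσ₁]
    have := hSre a ha
    linarith only [this]
  have hSim : ∀ a ∈ S, |a.im| ≤ |t| + 1 ∧ |a.im - t| ≤ η / 4 := by
    intro a ha
    have h1 : |(a - cc).im| ≤ ‖a - cc‖ := Complex.abs_im_le_norm _
    have h2 : (a - cc).im = a.im - t := by rw [Complex.sub_im, hccim]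
    rw [h2] at h1
    have h3 := (hS a ha).2.2
    have h4 := abs_sub_abs_le_abs_sub a.im t
    have h5 : |a.im - t| ≤ η / 4 := h1.trans h3
    refine ⟨?_, h5⟩
    linarith only [h4, h5, hη1]
  have hterm_re : ∀ a ∈ S, ((m a : ℂ) / (s₁ - a)).re = (m a : ℝ) * ((s₁ - a)⁻¹).re := by
    intro a _
    rw [div_eq_mul_inv, show ((m a : ℕ) : ℂ) = ((m a : ℝ) : ℂ) by simp, Complex.re_ofReal_mul]
  have hinv_nn : ∀ a ∈ S, 0 ≤ ((s₁ - a)⁻¹).re := by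
    intro a ha
    rw [Complex.inv_re]
    exact div_nonneg (hκ.le.trans (hSre₁ a ha)) (Complex.normSq_nonneg _)
  have hterm_nn : ∀ a ∈ S, 0 ≤ (m a : ℝ) * ((s₁ - a)⁻¹).re := fun a ha ↦
    mul_nonneg (Nat.cast_nonneg _) (hinv_nn a ha)
  have hsumre_eq : (∑ a ∈ S, (m a : ℂ) / (s₁ - a)).re =
      ∑ a ∈ S, (m a : ℝ) * ((s₁ - a)⁻¹).re := by
    rw [Complex.re_sum]; exact Finset.sum_congr rfl hterm_re
  -- split `S` into far and near zeros
  classical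
  obtain ⟨Sfar, hSfar⟩ : ∃ Sfar : Finset ℂ, Sfar = S.filter (fun a ↦ a.re ≤ 1 - 2 * c / ℒ) :=
    ⟨_, rfl⟩
  obtain ⟨Snear, hSnear⟩ :
      ∃ Snear : Finset ℂ, Snear = S.filter (fun a ↦ ¬ a.re ≤ 1 - 2 * c / ℒ) := ⟨_, rfl⟩
  -- the far zeros: `‖1/(s−a) − 1/(s₁−a)‖ ≤ Kc · Re 1/(s₁ − a)`
  have hfar : ∀ a ∈ Sfar, ‖(s - a)⁻¹ - (s₁ - a)⁻¹‖ ≤ Kc * ((s₁ - a)⁻¹).re := by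
    intro a ha
    rw [hSfar, Finset.mem_filter] at ha
    obtain ⟨haS, hare⟩ := ha
    have hw : s₁.re - s.re ≤ κ + c / ℒ := by
      rw [hs₁re, hσdef, hσ₁]; linarith only [hregion]
    have hdd : c / ℒ ≤ s.re - a.re := by
      rw [hσdef]; linarith only [hare, hregion, h2c]
    have hκκ : κ ≤ s₁.re - a.re := by
      have := hSre₁ a haS; simpa only [Complex.sub_re] using this
    have hσσ₁ : s.re ≤ s₁.re := by rw [hσdef, hs₁re]; exact hsmallσ.le
    have h' := ClassicalZFRData.norm_inv_sub_inv_le (s := s) (s₁ := s₁) (a := a)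
      (w := κ + c / ℒ) (d := c / ℒ) (κ := κ) (div_pos hcpos hℒ0) hκ
      (by rw [htdef, hs₁im]) hσσ₁ hw hdd hκκ
    exact h'.trans (mul_le_mul_of_nonneg_right hKc_ge (hinv_nn a haS))
  -- the near zeros are real, at distance `≥ d` from `s`, and force `|t| ≤ 1`
  have hnear : ∀ a ∈ Snear, a.im = 0 ∧ d ≤ ‖s - a‖ ∧ |t| ≤ 1 := by
    intro a ha
    rw [hSnear, Finset.mem_filter] at ha
    obtain ⟨haS, hare⟩ := ha
    obtain ⟨him, hds⟩ := hreal a (hS a haS).1 (hSim a haS).1 (not_le.1 hare)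
    refine ⟨him, hds, ?_⟩
    have := (hSim a haS).2
    rw [him, zero_sub, abs_neg] at this
    linarith only [this, hη1]
  have hnear_bd : ∀ a ∈ Snear, ‖(s - a)⁻¹ - (s₁ - a)⁻¹‖ ≤ 1 / d + 16 / η * ℒ := by
    intro a ha
    obtain ⟨-, hds, -⟩ := hnear a ha
    have haS : a ∈ S := (Finset.mem_filter.1 (by rw [hSnear] at ha; exact ha)).1
    have h1 : ‖(s - a)⁻¹‖ ≤ 1 / d := by
      rw [norm_inv, one_div]
      exact inv_anti₀ hd hds
    have h2 : ‖(s₁ - a)⁻¹‖ ≤ 16 / η * ℒ := by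
      rw [norm_inv]
      have hre : κ ≤ ‖s₁ - a‖ := (hSre₁ a haS).trans (Complex.re_le_norm _)
      calc ‖s₁ - a‖⁻¹ ≤ κ⁻¹ := inv_anti₀ hκ hre
        _ = 16 / η * ℒ := by rw [← one_div, hκinv]
    exact (norm_sub_le _ _).trans (add_le_add h1 h2)
  -- (1) `‖∑ m(a)/(s₁ − a)‖ ≤ Uℒ`
  have hL'₁ : ‖deriv F s₁ / F s₁‖ ≤ 16 / η * ℒ + K₀ := by
    have := h.norm_logDeriv_le_of_one_lt_re s₁ hs₁1
    have hσ₁le2 : σ₁ ≤ 2 := by rw [hσ₁]; linarith only [hκ1, hη1]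
    have hmin : min s₁.re 2 = σ₁ := by rw [hs₁re]; exact min_eq_left hσ₁le2
    rw [hmin, hσ₁, show 1 + κ - 1 = κ by ring, hκinv] at this
    exact this
  have hsum₁eq : ∑ a ∈ S, (m a : ℂ) / (s₁ - a) = deriv F s₁ / F s₁ - ψ s₁ := by
    rw [hψ₁]; ring
  have hsum₁ : ‖∑ a ∈ S, (m a : ℂ) / (s₁ - a)‖ ≤ U * ℒ := by
    rw [hsum₁eq]
    have h1 := norm_sub_le (deriv F s₁ / F s₁) (ψ s₁)
    have h2 := hψb s₁ hs₁cl
    rw [← hℒ] at h2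
    have h3 : (16 / η * ℒ + K₀) + E * ℒ ≤ U * ℒ := by rw [hU]; linear_combination hK₀ℒ
    linarith only [h1, hL'₁, h2, h3]
  have hsum₁re : ∑ a ∈ S, (m a : ℝ) * ((s₁ - a)⁻¹).re ≤ U * ℒ := by
    rw [← hsumre_eq]; exact (Complex.re_le_norm _).trans hsum₁
  -- (2) the near zeros, via the total multiplicity
  have hnear_sum : ∑ a ∈ Snear, (m a : ℝ) * ‖(s - a)⁻¹ - (s₁ - a)⁻¹‖ ≤
      25 / η * U * ℒ₀ ^ 2 * (1 / d + 20 / η * ℒ₀) := by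
    by_cases hne : Snear = ∅
    · rw [hne, Finset.sum_empty]; exact hX0
    · obtain ⟨a₀, ha₀⟩ := Finset.nonempty_iff_ne_empty.2 hne
      obtain ⟨-, -, ht⟩ := hnear a₀ ha₀
      have hnd : 0 ≤ 1 / d + 16 / η * ℒ := by positivity
      calc ∑ a ∈ Snear, (m a : ℝ) * ‖(s - a)⁻¹ - (s₁ - a)⁻¹‖
          ≤ ∑ a ∈ Snear, (m a : ℝ) * (1 / d + 16 / η * ℒ) :=
            Finset.sum_le_sum fun a ha ↦
              mul_le_mul_of_nonneg_left (hnear_bd a ha) (Nat.cast_nonneg _)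
        _ = (∑ a ∈ Snear, (m a : ℝ)) * (1 / d + 16 / η * ℒ) := (Finset.sum_mul _ _ _).symm
        _ ≤ (∑ a ∈ S, (m a : ℝ)) * (1 / d + 16 / η * ℒ) := by
            refine mul_le_mul_of_nonneg_right ?_ hnd
            exact Finset.sum_le_sum_of_subset_of_nonneg
              (by rw [hSnear]; exact Finset.filter_subset _ _) (fun a _ _ ↦ Nat.cast_nonneg _)
        _ ≤ (16 / η * U * ℒ ^ 2) * (1 / d + 16 / η * ℒ) := by
            refine mul_le_mul_of_nonneg_right ?_ hnd
            rw [hU]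
            convert hmult using 1
        _ ≤ 25 / η * U * ℒ₀ ^ 2 * (1 / d + 20 / η * ℒ₀) := hnearScale ht
  -- (3) the far sum: `≤ Kc · U ℒ`
  have hfar_sum : ∑ a ∈ Sfar, (m a : ℝ) * ‖(s - a)⁻¹ - (s₁ - a)⁻¹‖ ≤ Kc * (U * ℒ) := by
    calc ∑ a ∈ Sfar, (m a : ℝ) * ‖(s - a)⁻¹ - (s₁ - a)⁻¹‖
        ≤ ∑ a ∈ Sfar, (m a : ℝ) * (Kc * ((s₁ - a)⁻¹).re) :=
          Finset.sum_le_sum fun a ha ↦ mul_le_mul_of_nonneg_left (hfar a ha) (Nat.cast_nonneg _)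
      _ = Kc * ∑ a ∈ Sfar, (m a : ℝ) * ((s₁ - a)⁻¹).re := by
          rw [Finset.mul_sum]; exact Finset.sum_congr rfl fun a _ ↦ by ring
      _ ≤ Kc * ∑ a ∈ S, (m a : ℝ) * ((s₁ - a)⁻¹).re := by
          refine mul_le_mul_of_nonneg_left ?_ hKc0
          exact Finset.sum_le_sum_of_subset_of_nonneg
            (by rw [hSfar]; exact Finset.filter_subset _ _) (fun a ha _ ↦ hterm_nn a ha)
      _ ≤ Kc * (U * ℒ) := mul_le_mul_of_nonneg_left hsum₁re hKc0
  -- (4) assemble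
  have hsplit : ∑ a ∈ S, (m a : ℂ) / (s - a) =
      ∑ a ∈ S, (m a : ℂ) * ((s - a)⁻¹ - (s₁ - a)⁻¹) + ∑ a ∈ S, (m a : ℂ) / (s₁ - a) := by
    rw [← Finset.sum_add_distrib]
    exact Finset.sum_congr rfl fun a _ ↦ by ring
  have hdiff_sum : ‖∑ a ∈ S, (m a : ℂ) * ((s - a)⁻¹ - (s₁ - a)⁻¹)‖ ≤
      Kc * (U * ℒ) + 25 / η * U * ℒ₀ ^ 2 * (1 / d + 20 / η * ℒ₀) := by
    calc ‖∑ a ∈ S, (m a : ℂ) * ((s - a)⁻¹ - (s₁ - a)⁻¹)‖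
        ≤ ∑ a ∈ S, ‖(m a : ℂ) * ((s - a)⁻¹ - (s₁ - a)⁻¹)‖ := norm_sum_le _ _
      _ = ∑ a ∈ S, (m a : ℝ) * ‖(s - a)⁻¹ - (s₁ - a)⁻¹‖ :=
          Finset.sum_congr rfl fun a _ ↦ by rw [norm_mul, Complex.norm_natCast]
      _ = ∑ a ∈ Sfar, (m a : ℝ) * ‖(s - a)⁻¹ - (s₁ - a)⁻¹‖ +
            ∑ a ∈ Snear, (m a : ℝ) * ‖(s - a)⁻¹ - (s₁ - a)⁻¹‖ := by
          rw [hSfar, hSnear]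
          exact (Finset.sum_filter_add_sum_filter_not S _ _).symm
      _ ≤ Kc * (U * ℒ) + 25 / η * U * ℒ₀ ^ 2 * (1 / d + 20 / η * ℒ₀) :=
          add_le_add hfar_sum hnear_sum
  have hEq : deriv F s / F s = ψ s + ∑ a ∈ S, (m a : ℂ) / (s - a) := by
    rw [hψs]; ring
  have hψs_b := hψb s hscl
  rw [← hℒ] at hψs_b
  have hn1 := norm_add_le (ψ s)
    (∑ a ∈ S, (m a : ℂ) * ((s - a)⁻¹ - (s₁ - a)⁻¹) + ∑ a ∈ S, (m a : ℂ) / (s₁ - a))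
  have hn2 := norm_add_le (∑ a ∈ S, (m a : ℂ) * ((s - a)⁻¹ - (s₁ - a)⁻¹))
    (∑ a ∈ S, (m a : ℂ) / (s₁ - a))
  rw [hEq, hsplit]
  have hfinalineq : E * ℒ + ((Kc * (U * ℒ) + 25 / η * U * ℒ₀ ^ 2 * (1 / d + 20 / η * ℒ₀)) + U * ℒ) =
      (E + U + Kc * U) * ℒ + 25 / η * U * ℒ₀ ^ 2 * (1 / d + 20 / η * ℒ₀) := by ring
  linarith only [hn1, hn2, hψs_b, hdiff_sum, hsum₁, hfinalineq, htarget]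

end TwistedZFRData

end Literature.NumberTheory.LFunctions
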